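import Mathlib
import Literature.NumberTheory.GaloisRepresentations.LubinTateComparison
import Literature.NumberTheory.GaloisRepresentations.LubinTateMultiplicativeGroup
import Literature.NumberTheory.GaloisRepresentations.LubinTateComparisonPoints
import Literature.NumberTheory.GaloisRepresentations.LubinTateColemanLogDeriv
import Literature.NumberTheory.EllipticCurves.PAdicOneVariableSeriesFamilyOfRelNormCoherentUnits
import HarnessLib

/-!
# STUB-IDEAS k1-g38 — «TWISTED RIGIDITY»: the comparison pullback R218a «PULLBACK₂» (= k1-g37 K1 /
# H3′ = k3-g39 T3 `ComparisonChainRule`, «the only open piece» of its split of R218) PROVED — in its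
# strongest provable form, and VERBATIM in the docket's currency (§10, 0 sorry)

Route `PrintCf2`, crux `SplitBadTwoLowerHalfOfFacts` (stmt-BirchSwinnertonDyer-27851), stub
`stub_heegnerIndexLowerAtTwo`, docket item R218 PRIM₂ (STUB-PLAN v7.1 HARDEST (b)), residue H3′
«COMPARISON PULLBACK» of `Ideas/stub-heegnerindexloweratwo-k1-g37.md` (its K1, rank 2).

WEAKEST SUFFICIENT FORM (what `mahler_transport` of k1-g37 §10 consumes): `hcomp :
(1 + X) * d⁄dX (λ′ ∘ ϑ) = C ε` — §7 `hcomp_of_log_pullback` (verbatim shape) / `hcomp_of_pullback`.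
STRONGEST PROVABLE FORM (this file): for ANY commutative ring `A` with an endomorphism `φ`, ANY
`f ≡ πX (mod deg 2)`, and ANY series `D` with a twisted linear recursion `(D^φ ∘ f)·M₁ = D·M₂`, `D`
vanishes as soon as its first `n₀` coefficients do and `μ₂x = μ₁πⁿφ(x) ⇒ x = 0` for `n ≥ n₀`
(§2 `twisted_rigidity`) — no formal group law, no Lubin–Tate congruence `f ≡ X^q (mod π)`, no
homomorphism property / existence / uniqueness of `ϑ`, no field, no norm.  Consequences (0 sorry):
* §3 `hsep_of_isAdicComplete` — the separatedness hypothesis from `IsAdicComplete (span {π}) A` +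
  `φ π = π` (tree `LubinTate.eq_zero_of_eq_mul_map`), i.e. exactly the setting of `LubinTate.compSeries`;
* §4 `invDiff_pullback` — **`ϖ_f · ϑ′ = ε · ϖ_{f′}(ϑ)`** for every intertwiner `ϑ^φ ∘ f = f′ ∘ ϑ`,
  `ϑ ≡ εX`, `φ ε = u ε`, where `ϖ` is the tree's `invDiff` currency (`ϖ · [a]′ = a · ϖ ∘ [a]`,
  `LubinTate.invDiff_mul_derivative_hom` / `invDiff_mul_derivative_ltSer`): the invariant derivations
  `D_f = ϖ_f d/dX`, `D_{f′}` correspond under `ϑ` up to the period `ε` (de Shalit's `Ω`);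
* §5 `log_pullback` — **`λ_{f′} ∘ ϑ = ε · λ_f`** over any ring carrying the logarithms;
* §6 the frame at `v ∣ 2` split, `f = (1 + X)² − 1 = [2]_{𝔾̂_m}` (tree
  `LubinTate.isLTSeries_one_add_X_pow_sub_one 2`), `ϖ_f = 1 + X` (`invDiff_eq_frame`, proved):
  `frame_pullback_two` **`(1 + X) · ϑ′ = ε · ϖ′(ϑ)`**; §6b at log level over a `ℚ`-algebra with
  Mathlib's `PowerSeries.log` (`log_subst_frame : log((1+X)²) = 2 log(1+X)` proved):
  `frame_log_pullback_two` **`λ′ ∘ ϑ = ε · log(1 + X)`**;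
* §7 `hcomp_of_log_pullback` : **`(1 + X) · (λ′ ∘ ϑ)′ = C ε`** — literally `hcomp` of k1-g37's
  `mahler_transport` (`Ω = ε`); `hcomp_of_pullback`: the same from §6 in any algebra with `λ′′ · ϖ′ = 1`;
* §8 `invDiff_pullback_compSeries` / `frame_pullback_compSeries` — the instantiation on the tree's
  comparison series `ϑ = LubinTate.compSeries ι φ hA hf hf' hε` (`subst_compSeries`,
  `coeff_one_compSeries`, `constantCoeff_compSeries`, `IsTwistBase.eq_zero_of_mul_eq_zero`, `.map_eq`),
  with only `ϖ′` (the `invDiff` of `f′` read in `A`) left abstract through its defining identity;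
* §9 the H2 currency bridge `‖p⁻¹x‖ ≤ 1 ↔ x ∈ p·(unit ball)` (k1-g37 K2, XS).
* §10 ★★★★ `comparisonChainRuleC` / `comparisonChainRule_two` — **k3-g39's sub-stub T3
  `ComparisonChainRule h2 u hσ₀ hε` (body verbatim), for EVERY uniformiser `π` and every `q`**:
  `ω_f^ι · ϑ′ = C (coeff 1 ϑ) · ω_{f′}^ι(ϑ)` in `UnrCoeff F⟦X⟧` for `ϑ = compSeriesC hπ hσ₀ u hε`,
  `ω = LubinTate.invDiff (isLTRing_LTCoeff _) (isLTSeries_LTCoeff _)`; and over `𝒪̂_{F^nr}` itself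
  `invDiff_mul_derivative_ltComparison` for `ϑ = ltComparison hπ hσ₀ u hε`.  The six side conditions of §8
  are discharged BY NAME (`constantCoeff_invDiff`, `maxUnramifiedCompletion.galAut_algebraMap`,
  `invDiff_mul_derivative_ltSer`, `isTwistBase_galAut`, `isAdicComplete_span_unrPi`, `isLTSeries_ltPoly`).
  R218a (CRITIC-ROWS-g39 row 113 (π1), S⁻) is thereby KERNEL, and with it k3-g39's
  `boundedPrimitive_of_comparisonChainRule` has no open hypothesis left.

AUTOPSY (B65-class orientation slip, `autopsy_K1_as_typed{_coeff_one}`): k1-g37 typed H3′ as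
`(1 + X) * ((invDiff′).subst ϑ * ϑ′) = C ε`; with the tree's `invDiff = ϖ = 1/λ′` (docstring of
`LubinTate.invDiff`; `ϖ·[a]′ = a·ϖ∘[a]`) that statement together with the proved §6 forces
`2 · ϖ′₁ · ε² = 0`, false in the frame (`ε ∈ 𝒪̂ˣ_{ℚ₂^nr}`, `ϖ′₁ = 2/(π′² − π′) ≠ 0` for
`f′ = π′X + X²`): the correct `invDiff`-currency statement has `ϖ′(ϑ)` on the RIGHT (§6), the correct
`λ`-currency statement is `hcomp` (§7).  Nothing here proves BSD.
-/

noncomputable section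

open PowerSeries

namespace Summit.BirchSwinnertonDyer.BirchSwinnertonDyer.Cruxes.SplitBadTwoLowerHalfOfFacts.TwistedRigidityK1G38

variable {A : Type*} [CommRing A]

/-! ### §1 Helpers: constant terms through `subst`, `d⁄dX` -/

/-- `G(f)(0) = G(0)` when `f(0) = 0`. -/
theorem constantCoeff_subst_of_constantCoeff_eq_zero {f : A⟦X⟧} (hf : constantCoeff f = 0)
    (G : A⟦X⟧) : constantCoeff (G.subst f) = constantCoeff G := by
  have hs : HasSubst f := HasSubst.of_constantCoeff_zero' hf
  have h := PowerSeries.constantCoeff_subst hs G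
  rw [finsum_eq_single _ 0 (fun d hd => by
    rw [map_pow, show MvPowerSeries.constantCoeff f = constantCoeff f from rfl, hf, zero_pow hd,
      smul_zero])] at h
  rw [pow_zero, map_one, coeff_zero_eq_constantCoeff, smul_eq_mul, mul_one] at h
  exact h

/-- `(d⁄dX G)(0) = G₁`. -/
theorem constantCoeff_derivative' (G : A⟦X⟧) : constantCoeff (d⁄dX A G) = coeff 1 G := by
  rw [← coeff_zero_eq_constantCoeff_apply, coeff_derivative, Nat.cast_zero, zero_add, zero_add, mul_one]

/-- `(G^φ)(0) = φ(G(0))`. -/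
theorem constantCoeff_map' {T : Type*} [CommRing T] (φ : A →+* T) (G : A⟦X⟧) :
    constantCoeff (G.map φ) = φ (constantCoeff G) := by
  rw [← coeff_zero_eq_constantCoeff_apply, coeff_map, coeff_zero_eq_constantCoeff_apply]

/-- `d⁄dX` commutes with coefficientwise maps. -/
theorem derivative_map' {T : Type*} [CommRing T] (φ : A →+* T) (G : A⟦X⟧) :
    d⁄dX T (G.map φ) = (d⁄dX A G).map φ := by
  ext n
  simp only [coeff_derivative, coeff_map, map_mul, map_add, map_natCast, map_one]

/-- `subst` is multiplicative (spelling without `substAlgHom`). -/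
theorem subst_mul' {a : A⟦X⟧} (ha : HasSubst a) (G H : A⟦X⟧) :
    (G * H).subst a = G.subst a * H.subst a := by
  rw [← coe_substAlgHom ha, map_mul]

/-- One-variable spelling of `PowerSeries.map_subst`: `(G ∘ Ψ)^h = G^h ∘ Ψ^h`. -/
theorem map_subst_one' {T : Type*} [CommRing T] (h : A →+* T) {Ψ : A⟦X⟧} (hs : HasSubst Ψ)
    (G : A⟦X⟧) : PowerSeries.map h (G.subst Ψ) = (G.map h).subst (Ψ.map h) :=
  PowerSeries.map_subst hs G

/-- `(C r) ∘ a = C r` (one-variable spelling of `PowerSeries.subst_C`). -/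
theorem subst_C' (a : A⟦X⟧) (r : A) : (C r : A⟦X⟧).subst a = C r := by
  rw [PowerSeries.subst_C]
  rfl

/-- `(G ∘ ϑ)₁ = G₁ · ϑ₁` when `ϑ(0) = 0`. -/
theorem coeff_one_subst_of_constantCoeff_eq_zero {ϑ : A⟦X⟧} (hϑ : constantCoeff ϑ = 0) (G : A⟦X⟧) :
    coeff 1 (G.subst ϑ) = coeff 1 G * coeff 1 ϑ := by
  have hs : HasSubst ϑ := HasSubst.of_constantCoeff_zero' hϑ
  rw [← constantCoeff_derivative', derivative_subst A hs, map_mul,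
    constantCoeff_subst_of_constantCoeff_eq_zero hϑ, constantCoeff_derivative', constantCoeff_derivative']

/-- `f = X · g` with `g(0) = f₁` when `f(0) = 0`. -/
theorem exists_eq_X_mul_of_constantCoeff_eq_zero {f : A⟦X⟧} (hf : constantCoeff f = 0) :
    ∃ g : A⟦X⟧, f = X * g ∧ constantCoeff g = coeff 1 f := by
  obtain ⟨g, hg⟩ := X_dvd_iff.mpr hf
  refine ⟨g, hg, ?_⟩
  rw [hg, ← pow_one (X : A⟦X⟧), show (1 : ℕ) = 0 + 1 from rfl, coeff_X_pow_mul,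
    coeff_zero_eq_constantCoeff_apply]

/-! ### §2 Twisted rigidity (the strongest provable form)

If `(D^φ ∘ f) · M₁ = D · M₂` with `f ≡ πX (mod deg 2)`, `f(0) = 0`, the first `n₀` coefficients of `D`
vanish, and `μ₂ x = μ₁ πⁿ φ(x) ⟹ x = 0` for all `n ≥ n₀` (`μᵢ = Mᵢ(0)`), then `D = 0`: comparing the
lowest coefficient `d_n` of both sides gives exactly `μ₂ d_n = μ₁ πⁿ φ(d_n)`. -/

/-- **Twisted rigidity.** -/
theorem twisted_rigidity (φ : A →+* A) {π : A} {f : A⟦X⟧} (hf0 : constantCoeff f = 0)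
    (hf1 : coeff 1 f = π) {M₁ M₂ D : A⟦X⟧} {n₀ : ℕ} (hD : ∀ k, k < n₀ → coeff k D = 0)
    (hsep : ∀ n, n₀ ≤ n → ∀ x : A,
      constantCoeff M₂ * x = constantCoeff M₁ * π ^ n * φ x → x = 0)
    (heq : (D.map φ).subst f * M₁ = D * M₂) : D = 0 := by
  have hs : HasSubst f := HasSubst.of_constantCoeff_zero' hf0
  obtain ⟨g, hg, hg0⟩ := exists_eq_X_mul_of_constantCoeff_eq_zero hf0
  rw [hf1] at hg0
  have key : ∀ N, n₀ ≤ N → ∀ k, k < N → coeff k D = 0 := by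
    intro N hN
    induction N, hN using Nat.le_induction with
    | base => exact hD
    | succ N hN ih =>
      obtain ⟨E, hE⟩ := (X_pow_dvd_iff (φ := D)).mpr ih
      have hND : coeff N D = constantCoeff E := by
        have h := coeff_X_pow_mul E N 0
        rw [zero_add, coeff_zero_eq_constantCoeff_apply] at h
        rw [hE, h]
      have lhs : (D.map φ).subst f * M₁ = X ^ N * (g ^ N * (E.map φ).subst f * M₁) := by
        rw [hE, map_mul, map_pow, map_X, ← coe_substAlgHom hs, map_mul, map_pow, coe_substAlgHom,
          subst_X hs, hg, mul_pow]
        ring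
      have rhs : D * M₂ = X ^ N * (E * M₂) := by rw [hE, mul_assoc]
      have h1 := congrArg (coeff (0 + N)) heq
      rw [lhs, rhs, coeff_X_pow_mul, coeff_X_pow_mul, coeff_zero_eq_constantCoeff_apply,
        coeff_zero_eq_constantCoeff_apply, map_mul, map_mul, map_mul, map_pow, hg0,
        constantCoeff_subst_of_constantCoeff_eq_zero hf0, constantCoeff_map'] at h1
      have he : constantCoeff E = 0 :=
        hsep N hN (constantCoeff E) (by linear_combination -h1)
      intro k hk
      rcases Nat.lt_succ_iff_lt_or_eq.mp hk with hk | rfl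
      · exact ih k hk
      · rw [hND, he]
  ext k
  rw [map_zero]
  exact key (max (k + 1) n₀) (le_max_right _ _) k
    (lt_of_lt_of_le (Nat.lt_succ_self k) (le_max_left _ _))

/-! ### §3 Discharging the separatedness hypothesis

In a `(π)`-adically complete and separated ring with `φ π = π` (the tree's setting of
`LubinTate.compSeries`: `IsAdicComplete (Ideal.span {ι π₀}) A`, `IsTwistBase.map_eq`,
`IsTwistBase.eq_zero_of_mul_eq_zero`), `u x = πⁿ φ(x)` with `u` a unit and `n ≥ 1` forces `x = 0`
(tree `LubinTate.eq_zero_of_eq_mul_map`). -/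

/-- Cancel a power of a non-zero-divisor. -/
theorem eq_zero_of_pow_mul_eq_zero {π : A} (hreg : ∀ x : A, π * x = 0 → x = 0) (m : ℕ) {x : A}
    (h : π ^ m * x = 0) : x = 0 := by
  induction m generalizing x with
  | zero => simpa using h
  | succ m ih =>
    rw [pow_succ, mul_assoc] at h
    exact hreg _ (ih h)

/-- **`hsep` from adic completeness** (`u` a unit, `φ π = π`, `n ≥ 1`). -/
theorem hsep_of_isAdicComplete {π : A} [IsAdicComplete (Ideal.span {π}) A] (φ : A →+* A)
    (hφ : φ π = π) (u : Aˣ) {n : ℕ} (hn : 1 ≤ n) {x : A} (h : (u : A) * x = π ^ n * φ x) :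
    x = 0 := by
  obtain ⟨k, rfl⟩ := Nat.exists_eq_add_of_le' hn
  refine Literature.NumberTheory.GaloisRepresentations.LubinTate.eq_zero_of_eq_mul_map π φ hφ
    (lam := ((u⁻¹ : Aˣ) : A) * π ^ (k + 1)) (Dvd.intro_left (((u⁻¹ : Aˣ) : A) * π ^ k) (by ring)) ?_
  have hu : ((u⁻¹ : Aˣ) : A) * (u : A) = 1 := Units.inv_mul u
  linear_combination ((u⁻¹ : Aˣ) : A) * h - x * hu

/-! ### §4 The invariant derivations correspond under `ϑ` up to `ε` (tree `invDiff` currency)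

`ϖ` below is the tree's `invDiff` (`ω_F(Y) = ∂F/∂X(0,Y) = 1/λ′`), characterised by `ϖ · f′ = π · ϖ ∘ f`
(`LubinTate.invDiff_mul_derivative_hom` with `a = π`, `LubinTate.invDiff_mul_derivative_ltSer`);
`ϑ` is ANY series with `ϑ ≡ εX (mod deg 2)` and `ϑ^φ ∘ f = f′ ∘ ϑ` (`LubinTate.subst_compSeries`,
`coeff_one_compSeries`, `constantCoeff_compSeries`).  No formal group law is used. -/

/-- ★ **Twisted pullback of the invariant derivation**: `ϖ_f · ϑ′ = ε · ϖ_{f′}(ϑ)`. -/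
theorem invDiff_pullback (φ : A →+* A) {π u ε : A} {f f' ϖ ϖ' ϑ : A⟦X⟧}
    (hf0 : constantCoeff f = 0) (hf1 : coeff 1 f = π)
    (hf'0 : constantCoeff f' = 0) (hf'1 : coeff 1 f' = u * π)
    (hϖ0 : constantCoeff ϖ = 1) (hϖφ : ϖ.map φ = ϖ) (hEf : ϖ * d⁄dX A f = C π * ϖ.subst f)
    (hϖ'0 : constantCoeff ϖ' = 1) (hϖ'φ : ϖ'.map φ = ϖ')
    (hEf' : ϖ' * d⁄dX A f' = C (u * π) * ϖ'.subst f')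
    (hϑ0 : constantCoeff ϑ = 0) (hϑ1 : coeff 1 ϑ = ε) (hε : φ ε = u * ε)
    (hϑ : (ϑ.map φ).subst f = f'.subst ϑ)
    (hreg : ∀ x : A, π * x = 0 → x = 0)
    (hsep : ∀ n, 1 ≤ n → ∀ x : A, u * x = π ^ n * φ x → x = 0) :
    ϖ * d⁄dX A ϑ = C ε * ϖ'.subst ϑ := by
  have hs : HasSubst f := HasSubst.of_constantCoeff_zero' hf0
  have hs' : HasSubst f' := HasSubst.of_constantCoeff_zero' hf'0
  have hsϑ : HasSubst ϑ := HasSubst.of_constantCoeff_zero' hϑ0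
  have hϑφ0 : constantCoeff (ϑ.map φ) = 0 := by rw [constantCoeff_map', hϑ0, map_zero]
  have hsϑφ : HasSubst (ϑ.map φ) := HasSubst.of_constantCoeff_zero' hϑφ0
  rw [← sub_eq_zero]
  set D : A⟦X⟧ := ϖ * d⁄dX A ϑ - C ε * ϖ'.subst ϑ with hD_def
  refine twisted_rigidity φ hf0 hf1 (M₁ := C π * d⁄dX A f)
    (M₂ := d⁄dX A f * (d⁄dX A f').subst ϑ) (n₀ := 1) (D := D) (fun k hk => ?_)
    (fun n hn x hx => ?_) ?_
  · obtain rfl : k = 0 := by omega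
    rw [coeff_zero_eq_constantCoeff_apply, hD_def, map_sub, map_mul, map_mul, hϖ0,
      constantCoeff_derivative', hϑ1, constantCoeff_C,
      constantCoeff_subst_of_constantCoeff_eq_zero hϑ0, hϖ'0]
    ring
  · rw [map_mul, map_mul, constantCoeff_C, constantCoeff_derivative', hf1,
      constantCoeff_subst_of_constantCoeff_eq_zero hϑ0, constantCoeff_derivative', hf'1] at hx
    have h2 := eq_zero_of_pow_mul_eq_zero hreg 2 (x := u * x - π ^ n * φ x)
      (by linear_combination hx)
    exact hsep n hn x (sub_eq_zero.mp h2)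
  · -- the three functional identities, all read in `A⟦X⟧`
    -- (a) `C π · ϖ(f) = ϖ · f′`                                  [hEf]
    -- (b) `(ϑ^φ)′(f) · f′ = (f′)′(ϑ) · ϑ′`                        [chain rule on hϑ]
    -- (c) `C (uπ) · (ϖ′ ∘ f′)(ϑ) = ϖ′(ϑ) · (f′)′(ϑ)`              [hEf′ read at ϑ]
    have hb : (d⁄dX A (ϑ.map φ)).subst f * d⁄dX A f =
        (d⁄dX A f').subst ϑ * d⁄dX A ϑ := by
      rw [← derivative_subst A hs, hϑ, derivative_subst A hsϑ]
    have hc : C (u * π) * PowerSeries.subst ϑ (ϖ'.subst f') =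
        ϖ'.subst ϑ * (d⁄dX A f').subst ϑ := by
      have h : (ϖ' * d⁄dX A f').subst ϑ =
          PowerSeries.subst ϑ (C (u * π) * ϖ'.subst f' : A⟦X⟧) := by
        rw [hEf']
      rw [subst_mul' hsϑ, subst_mul' hsϑ, subst_C'] at h
      exact h.symm
    have hDφ : (D.map φ).subst f =
        ϖ.subst f * (d⁄dX A (ϑ.map φ)).subst f -
          C (u * ε) * PowerSeries.subst ϑ (ϖ'.subst f') := by
      rw [hD_def, map_sub, map_mul, map_mul, hϖφ, ← derivative_map', map_C, hε,
        map_subst_one' φ hsϑ, hϖ'φ, PowerSeries.subst_sub hs, subst_mul' hs, subst_mul' hs,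
        subst_C', PowerSeries.subst_comp_subst_apply hsϑφ hs, hϑ,
        ← PowerSeries.subst_comp_subst_apply hs' hsϑ]
    rw [hDφ, hD_def]
    simp only [map_mul] at hc ⊢
    linear_combination ((d⁄dX A (ϑ.map φ)).subst f * d⁄dX A f) * hEf.symm
      + (ϖ * d⁄dX A f) * hb - (C ε * d⁄dX A f) * hc

/-! ### §5 `ϑ` intertwines the logarithms: `λ_{f′} ∘ ϑ = ε · λ_f`

Over any ring `A` carrying the logarithms (`λ ∘ f = π λ`, `λ′ ∘ f′ = π′ λ′`, `λ ≡ λ′ ≡ X (mod deg 2)`;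
tree `ltLog`, `subst_ltPolyF_ltLog`, `eq_ltLog` over the field `F`), with the separatedness hypothesis
now starting at `n = 2`. -/

/-- ★ **`λ_{f′} ∘ ϑ = ε · λ_f`.** -/
theorem log_pullback (φ : A →+* A) {π u ε : A} {f f' lam lam' ϑ : A⟦X⟧}
    (hf0 : constantCoeff f = 0) (hf1 : coeff 1 f = π) (hf'0 : constantCoeff f' = 0)
    (hlam0 : constantCoeff lam = 0) (hlam1 : coeff 1 lam = 1) (hlamφ : lam.map φ = lam)
    (hlamf : lam.subst f = C π * lam)
    (hlam'0 : constantCoeff lam' = 0) (hlam'1 : coeff 1 lam' = 1) (hlam'φ : lam'.map φ = lam')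
    (hlam'f : lam'.subst f' = C (u * π) * lam')
    (hϑ0 : constantCoeff ϑ = 0) (hϑ1 : coeff 1 ϑ = ε) (hε : φ ε = u * ε)
    (hϑ : (ϑ.map φ).subst f = f'.subst ϑ)
    (hsep : ∀ n, 2 ≤ n → ∀ x : A, u * π * x = π ^ n * φ x → x = 0) :
    lam'.subst ϑ = C ε * lam := by
  have hs : HasSubst f := HasSubst.of_constantCoeff_zero' hf0
  have hs' : HasSubst f' := HasSubst.of_constantCoeff_zero' hf'0
  have hsϑ : HasSubst ϑ := HasSubst.of_constantCoeff_zero' hϑ0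
  have hϑφ0 : constantCoeff (ϑ.map φ) = 0 := by rw [constantCoeff_map', hϑ0, map_zero]
  have hsϑφ : HasSubst (ϑ.map φ) := HasSubst.of_constantCoeff_zero' hϑφ0
  rw [← sub_eq_zero]
  set D : A⟦X⟧ := lam'.subst ϑ - C ε * lam with hD_def
  refine twisted_rigidity φ hf0 hf1 (M₁ := 1) (M₂ := C (u * π)) (n₀ := 2) (D := D)
    (fun k hk => ?_) (fun n hn x hx => ?_) ?_
  · interval_cases k
    · rw [coeff_zero_eq_constantCoeff_apply, hD_def, map_sub, map_mul,
        constantCoeff_subst_of_constantCoeff_eq_zero hϑ0, hlam'0, hlam0, mul_zero, sub_zero]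
    · rw [hD_def, map_sub, coeff_one_subst_of_constantCoeff_eq_zero hϑ0, hlam'1, hϑ1,
        coeff_C_mul, hlam1]
      ring
  · rw [map_one, constantCoeff_C, one_mul] at hx
    exact hsep n hn x hx
  · have hDφ : (D.map φ).subst f =
        PowerSeries.subst ϑ (lam'.subst f') - C (u * ε) * (C π * lam) := by
      rw [hD_def, map_sub, map_mul, map_C, hε, map_subst_one' φ hsϑ, hlam'φ,
        PowerSeries.subst_sub hs, subst_mul' hs, subst_C',
        PowerSeries.subst_comp_subst_apply hsϑφ hs, hϑ,
        ← PowerSeries.subst_comp_subst_apply hs' hsϑ, hlamφ, hlamf]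
    rw [hDφ, hlam'f, subst_mul' hsϑ, subst_C', hD_def]
    simp only [map_mul, mul_one]
    ring

/-! ### §6 The frame at `v ∣ 2` split: `𝔾̂_m = F_{2X + X²}`, `ϖ_{𝔾̂_m} = 1 + X`

For `F = ℚ₂`, `q = 2`, `π₀ = 2`: `f = 2X + X² = (1+X)² − 1 = [2]_{𝔾̂_m}` (tree `ltPoly`/`ltSer` at `π = 2`,
`LubinTateMultiplicativeBase`), and `ϖ = 1 + X` satisfies `ϖ · f′ = 2 · ϖ ∘ f` by direct computation,
so §4 specialises with NO appeal to the identification `F_f = 𝔾̂_m`. -/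

/-- `f(0) = 0` for the frame series `f = (1 + X)² − 1`. -/
theorem frame_constantCoeff : constantCoeff ((1 + X : A⟦X⟧) ^ 2 - 1) = 0 := by simp

/-- `f ≡ 2X (mod deg 2)`. -/
theorem frame_coeff_one : coeff 1 ((1 + X : A⟦X⟧) ^ 2 - 1) = 2 := by
  rw [Literature.NumberTheory.GaloisRepresentations.LubinTate.coeff_one_add_X_pow_sub_one]
  norm_num

theorem frame_hasSubst : HasSubst ((1 + X : A⟦X⟧) ^ 2 - 1) :=
  HasSubst.of_constantCoeff_zero' frame_constantCoeff

/-- `(1 + X) ∘ f = (1 + X)²`. -/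
theorem subst_one_add_X_frame :
    (1 + X : A⟦X⟧).subst ((1 + X : A⟦X⟧) ^ 2 - 1) = (1 + X) ^ 2 := by
  rw [← coe_substAlgHom frame_hasSubst, map_add, map_one, coe_substAlgHom,
    subst_X frame_hasSubst]
  ring

/-- `f′ = 2(1 + X)`. -/
theorem deriv_frame : d⁄dX A ((1 + X : A⟦X⟧) ^ 2 - 1) = 2 * (1 + X) := by
  rw [sq, show (1 + X : A⟦X⟧) * (1 + X) - 1 = X + X + X * X by ring, map_add, map_add,
    (d⁄dX A).leibniz, derivative_X, smul_eq_mul]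
  ring

/-- `(1 + X) · f′ = 2 · (1 + X) ∘ f` (both are `2(1+X)²`): `ϖ_{𝔾̂_m} = 1 + X` satisfies the
`[2]`-equivariance `hEf` of §4 for `f = (1 + X)² − 1`. -/
theorem invDiff_eq_frame :
    (1 + X : A⟦X⟧) * d⁄dX A ((1 + X : A⟦X⟧) ^ 2 - 1) =
      C 2 * (1 + X : A⟦X⟧).subst ((1 + X : A⟦X⟧) ^ 2 - 1) := by
  rw [subst_one_add_X_frame, deriv_frame, map_ofNat]
  ring

/-- ★★ **The frame pullback (corrected K1/H3′ in `invDiff` currency)**, `f = (1 + X)² − 1 = [2]_{𝔾̂_m}`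
(tree `LubinTate.isLTSeries_one_add_X_pow_sub_one 2`):
`(1 + X) · ϑ′ = ε · ϖ′(ϑ)` for every intertwiner `ϑ^φ ∘ f = f′ ∘ ϑ` with `ϑ ≡ εX`, `φ ε = u ε`. -/
theorem frame_pullback_two (φ : A →+* A) {u ε : A} {f' ϖ' ϑ : A⟦X⟧}
    (hf'0 : constantCoeff f' = 0) (hf'1 : coeff 1 f' = u * 2)
    (hϖ'0 : constantCoeff ϖ' = 1) (hϖ'φ : ϖ'.map φ = ϖ')
    (hEf' : ϖ' * d⁄dX A f' = C (u * 2) * ϖ'.subst f')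
    (hϑ0 : constantCoeff ϑ = 0) (hϑ1 : coeff 1 ϑ = ε) (hε : φ ε = u * ε)
    (hϑ : (ϑ.map φ).subst ((1 + X : A⟦X⟧) ^ 2 - 1) = f'.subst ϑ)
    (hreg : ∀ x : A, 2 * x = 0 → x = 0)
    (hsep : ∀ n, 1 ≤ n → ∀ x : A, u * x = 2 ^ n * φ x → x = 0) :
    (1 + X : A⟦X⟧) * d⁄dX A ϑ = C ε * ϖ'.subst ϑ :=
  invDiff_pullback φ (f := (1 + X : A⟦X⟧) ^ 2 - 1) (ϖ := 1 + X) frame_constantCoeff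
    frame_coeff_one hf'0 hf'1 (by simp) (by rw [map_add, map_one, map_X]) invDiff_eq_frame hϖ'0 hϖ'φ
    hEf' hϑ0 hϑ1 hε hϑ hreg hsep

/-! ### §6b The frame at the level of logarithms: `λ_{𝔾̂_m} = log(1 + X)` (Mathlib `PowerSeries.log`)

Over a `ℚ`-algebra `E` (the fields `K̂^{nr} ⊂ ℂ₂` of the docket) the logarithm of `F_f = 𝔾̂_m` is
`log(1 + X)`; its `[2]`-functional equation `log((1+X)²) = 2·log(1+X)` is proved here from
`(1 + X)·log′ = 1` and `PowerSeries.derivative.ext`, so §5 specialises with no hypothesis on `𝔾̂_m` left. -/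

/-- `(1 + X) · (log(1+X))′ = 1`. -/
theorem one_add_X_mul_deriv_log [Algebra ℚ A] : (1 + X : A⟦X⟧) * d⁄dX A (log A) = 1 := by
  ext n
  rw [deriv_log, add_mul, one_mul, map_add, coeff_one]
  rcases n with _ | n
  · simp
  · rw [coeff_succ_X_mul, coeff_mk, coeff_mk, if_neg n.succ_ne_zero, ← map_add, pow_succ]
    simp

/-- **`log((1 + X)²) = 2 · log(1 + X)`**: the `[2]_{𝔾̂_m}`-functional equation of `λ_{𝔾̂_m}`. -/
theorem log_subst_frame [Algebra ℚ A] [IsAddTorsionFree A] :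
    (log A).subst ((1 + X : A⟦X⟧) ^ 2 - 1) = C 2 * log A := by
  have hs : HasSubst ((1 + X : A⟦X⟧) ^ 2 - 1) := frame_hasSubst
  have hG : (1 + X : A⟦X⟧) ^ 2 * (d⁄dX A (log A)).subst ((1 + X : A⟦X⟧) ^ 2 - 1) = 1 := by
    have h : ((1 + X : A⟦X⟧) * d⁄dX A (log A)).subst ((1 + X : A⟦X⟧) ^ 2 - 1) =
        (1 : A⟦X⟧).subst ((1 + X : A⟦X⟧) ^ 2 - 1) := by rw [one_add_X_mul_deriv_log]
    have h1 : (1 : A⟦X⟧).subst ((1 + X : A⟦X⟧) ^ 2 - 1) = 1 := by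
      rw [← coe_substAlgHom hs, map_one]
    rwa [subst_mul' hs, subst_one_add_X_frame, h1] at h
  have hu : IsUnit ((1 + X : A⟦X⟧) ^ 2) := by
    refine IsUnit.pow 2 ?_
    rw [PowerSeries.isUnit_iff_constantCoeff]
    simp
  refine derivative.ext (hu.mul_left_cancel ?_) ?_
  · rw [derivative_subst A hs, deriv_frame, (d⁄dX A).leibniz (C (2 : A)) (log A), derivative_C,
      smul_zero, add_zero, smul_eq_mul,
      show (1 + X : A⟦X⟧) ^ 2 * ((d⁄dX A (log A)).subst ((1 + X : A⟦X⟧) ^ 2 - 1) * (2 * (1 + X)))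
        = ((1 + X : A⟦X⟧) ^ 2 * (d⁄dX A (log A)).subst ((1 + X : A⟦X⟧) ^ 2 - 1)) * (2 * (1 + X))
        by ring, hG,
      show (1 + X : A⟦X⟧) ^ 2 * (C (2 : A) * d⁄dX A (log A))
        = C 2 * (1 + X) * ((1 + X) * d⁄dX A (log A)) by ring, one_add_X_mul_deriv_log, map_ofNat]
    ring
  · rw [constantCoeff_subst_of_constantCoeff_eq_zero frame_constantCoeff, map_mul, constantCoeff_log,
      mul_zero]

/-- ★★ **The frame pullback at log level**: `λ′ ∘ ϑ = ε · log(1 + X)` for every intertwiner `ϑ`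
(`ϑ^φ ∘ ((1+X)² − 1) = f′ ∘ ϑ`, `ϑ ≡ εX`, `φ ε = u ε`) and every `φ`-fixed normalised solution `λ′` of
`λ′ ∘ f′ = 2u · λ′` (tree: `LubinTate.ltLog`, `subst_ltPolyF_ltLog`, coefficients in `F`). -/
theorem frame_log_pullback_two [Algebra ℚ A] [IsAddTorsionFree A] (φ : A →+* A) {u ε : A}
    {f' lam' ϑ : A⟦X⟧} (hf'0 : constantCoeff f' = 0)
    (hlam'0 : constantCoeff lam' = 0) (hlam'1 : coeff 1 lam' = 1) (hlam'φ : lam'.map φ = lam')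
    (hlam'f : lam'.subst f' = C (u * 2) * lam')
    (hϑ0 : constantCoeff ϑ = 0) (hϑ1 : coeff 1 ϑ = ε) (hε : φ ε = u * ε)
    (hϑ : (ϑ.map φ).subst ((1 + X : A⟦X⟧) ^ 2 - 1) = f'.subst ϑ)
    (hsep : ∀ n, 2 ≤ n → ∀ x : A, u * 2 * x = 2 ^ n * φ x → x = 0) :
    lam'.subst ϑ = C ε * log A :=
  log_pullback φ (f := (1 + X : A⟦X⟧) ^ 2 - 1) (lam := log A) frame_constantCoeff frame_coeff_one
    hf'0 constantCoeff_log coeff_one_log (map_log φ) log_subst_frame hlam'0 hlam'1 hlam'φ hlam'f hϑ0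
    hϑ1 hε hϑ hsep

/-- AUTOPSY of K1 as typed in k1-g37 (`(1 + X)·(ϖ′∘ϑ)·ϑ′ = C ε` with `ϖ′ = invDiff′`): together with
the (proved) corrected identity it forces `ε · ((ϖ′∘ϑ)² − 1) = 0`, i.e. at order `X¹`:
`2 · ϖ′₁ · ε² = 0` — false in the frame (`ε` a unit of the domain `𝒪̂_{ℚ₂^nr}`, `ϖ′₁ = 2/(π′² − π′) ≠ 0`
from `hEf′` at order `X¹` for `f′ = π′X + X²`). -/
theorem autopsy_K1_as_typed {ε : A} {ϖ' ϑ : A⟦X⟧}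
    (hP : (1 + X : A⟦X⟧) * d⁄dX A ϑ = C ε * ϖ'.subst ϑ)
    (hQ : (1 + X : A⟦X⟧) * (ϖ'.subst ϑ * d⁄dX A ϑ) = C ε) :
    C ε * ((ϖ'.subst ϑ) ^ 2 - 1) = 0 := by
  linear_combination hQ - ϖ'.subst ϑ * hP

/-- … and its linear coefficient: `2 · ϖ′₁ · ε² = 0` (with `ϑ ≡ εX`). -/
theorem autopsy_K1_as_typed_coeff_one {ε : A} {ϖ' ϑ : A⟦X⟧} (hϖ'0 : constantCoeff ϖ' = 1)
    (hϑ0 : constantCoeff ϑ = 0) (hϑ1 : coeff 1 ϑ = ε)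
    (hP : (1 + X : A⟦X⟧) * d⁄dX A ϑ = C ε * ϖ'.subst ϑ)
    (hQ : (1 + X : A⟦X⟧) * (ϖ'.subst ϑ * d⁄dX A ϑ) = C ε) :
    2 * coeff 1 ϖ' * ε ^ 2 = 0 := by
  have hS0 : constantCoeff (ϖ'.subst ϑ) = 1 := by
    rw [constantCoeff_subst_of_constantCoeff_eq_zero hϑ0, hϖ'0]
  have hS1 : coeff 1 (ϖ'.subst ϑ) = coeff 1 ϖ' * ε := by
    rw [coeff_one_subst_of_constantCoeff_eq_zero hϑ0, hϑ1]
  have h := congrArg (coeff 1) (autopsy_K1_as_typed hP hQ)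
  rw [coeff_C_mul, map_sub, sq, coeff_one_mul, hS0, hS1, coeff_one, if_neg one_ne_zero,
    map_zero] at h
  linear_combination h

/-! ### §7 The weakest sufficient form: `hcomp` of k1-g37's `mahler_transport`

In any `A`-algebra `B` (the field `E`/`K̂^{nr}`/`ℂ₂` of the docket) where the logarithm `λ′` of `F_{f′}`
lives with `λ′′ · ϖ′ = 1` (`ϖ′ = 1/λ′′`, docstring of `LubinTate.invDiff`; tree `ltLog`), the frame
pullback gives literally `hcomp : (1 + X) * d⁄dX (λ′ ∘ ϑ) = C ε`. -/

/-- ★★ **`hcomp`**: `(1 + X) · (λ′ ∘ ϑ)′ = ε`. -/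
theorem hcomp_of_pullback {B : Type*} [CommRing B] (ι : A →+* B) {ε : A} {ϖ' ϑ : A⟦X⟧}
    {lam : B⟦X⟧} (hϑ0 : constantCoeff ϑ = 0)
    (hpull : (1 + X : A⟦X⟧) * d⁄dX A ϑ = C ε * ϖ'.subst ϑ)
    (hlam : d⁄dX B lam * ϖ'.map ι = 1) :
    (1 + X : B⟦X⟧) * d⁄dX B (lam.subst (ϑ.map ι)) = C (ι ε) := by
  have hsϑ : HasSubst ϑ := HasSubst.of_constantCoeff_zero' hϑ0
  have hϑι0 : constantCoeff (ϑ.map ι) = 0 := by rw [constantCoeff_map', hϑ0, map_zero]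
  have hsϑι : HasSubst (ϑ.map ι) := HasSubst.of_constantCoeff_zero' hϑι0
  have h := congrArg (PowerSeries.map ι) hpull
  rw [map_mul, map_mul, map_add, map_one, map_X, ← derivative_map', map_C,
    map_subst_one' ι hsϑ] at h
  have h1 : (d⁄dX B lam).subst (ϑ.map ι) * (ϖ'.map ι).subst (ϑ.map ι) = 1 := by
    rw [← subst_mul' hsϑι, hlam, ← coe_substAlgHom hsϑι, map_one]
  rw [derivative_subst B hsϑι]
  linear_combination (d⁄dX B lam).subst (ϑ.map ι) * h + C (ι ε) * h1

/-- ★★★ **`hcomp` VERBATIM (k1-g37 `mahler_transport`), from the log-level pullback**: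
`(1 + X) · (λ′ ∘ ϑ)′ = C ε` — no `ϖ′`, no `λ′′·ϖ′ = 1` needed. -/
theorem hcomp_of_log_pullback [Algebra ℚ A] {ε : A} {lam' ϑ : A⟦X⟧}
    (hlog : lam'.subst ϑ = C ε * log A) :
    (1 + X : A⟦X⟧) * d⁄dX A (lam'.subst ϑ) = C ε := by
  rw [hlog, (d⁄dX A).leibniz (C ε) (log A), derivative_C, smul_zero, add_zero, smul_eq_mul,
    show (1 + X : A⟦X⟧) * (C ε * d⁄dX A (log A)) = C ε * ((1 + X) * d⁄dX A (log A)) by ring,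
    one_add_X_mul_deriv_log, mul_one]

/-! ### §8 Instantiation on the tree's comparison series `LubinTate.compSeries`

The hypotheses `hϑ0/hϑ1/hϑ/hreg/hsep/φ π = π` of §4 are, BY NAME, `constantCoeff_compSeries`,
`coeff_one_compSeries`, `subst_compSeries`, `IsTwistBase.eq_zero_of_mul_eq_zero`, §3, `IsTwistBase.map_eq`;
what remains abstract is only the pair `ϖ, ϖ′` with their defining identities (`invDiff` of `f`, `f′`
read in `A`: `LubinTate.invDiff_mul_derivative_hom _ _ hinj π` mapped by `ι`). -/

section TreeInstantiation

open Literature.NumberTheory.GaloisRepresentations Literature.NumberTheory.GaloisRepresentations.LubinTate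

variable {𝒪 : Type*} [CommRing 𝒪] (ι : 𝒪 →+* A) (φ : A →+* A) {π₀ : 𝒪} {q : ℕ}
  {u₀ : 𝒪ˣ} {f f' : PowerSeries 𝒪} [IsAdicComplete (Ideal.span {ι π₀}) A]
  (hA : IsTwistBase (ι π₀) q φ)
  (hf : IsLTSeries π₀ q f) (hf' : IsLTSeries ((u₀ : 𝒪) * π₀) q f') {ε : A} (hε : φ ε = ι u₀ * ε)

/-- ★★ **H3′ for `ϑ = LubinTate.compSeries ι φ hA hf hf' hε`**: `ϖ_f · ϑ′ = ε · ϖ_{f′}(ϑ)`. -/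
theorem invDiff_pullback_compSeries {ϖ ϖ' : A⟦X⟧}
    (hϖ0 : constantCoeff ϖ = 1) (hϖφ : ϖ.map φ = ϖ)
    (hEf : ϖ * d⁄dX A (f.map ι) = C (ι π₀) * ϖ.subst (f.map ι))
    (hϖ'0 : constantCoeff ϖ' = 1) (hϖ'φ : ϖ'.map φ = ϖ')
    (hEf' : ϖ' * d⁄dX A (f'.map ι) = C (ι u₀ * ι π₀) * ϖ'.subst (f'.map ι)) :
    ϖ * d⁄dX A (compSeries ι φ hA hf hf' hε) =
      C ε * ϖ'.subst (compSeries ι φ hA hf hf' hε) :=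
  invDiff_pullback φ (π := ι π₀) (u := ι u₀)
    (by rw [constantCoeff_map', hf.constantCoeff_eq_zero, map_zero])
    (by rw [coeff_map, hf.coeff_one])
    (by rw [constantCoeff_map', hf'.constantCoeff_eq_zero, map_zero])
    (by rw [coeff_map, hf'.coeff_one, map_mul])
    hϖ0 hϖφ hEf hϖ'0 hϖ'φ hEf'
    (constantCoeff_compSeries ι φ hA hf hf' hε) (coeff_one_compSeries ι φ hA hf hf' hε) hε
    (subst_compSeries ι φ hA hf hf' hε).symm hA.eq_zero_of_mul_eq_zero
    (fun n hn x hx => hsep_of_isAdicComplete φ hA.map_eq (unitMap ι u₀) hn (by simpa using hx))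

/-- ★★★ **The frame case on the tree's `compSeries`** (`ι π₀ = 2`, `f^ι = (1 + X)² − 1`):
`(1 + X) · ϑ′ = ε · ϖ′(ϑ)`, `ϑ = LubinTate.compSeries …` — K1/H3′ of k1-g37 with only `ϖ′` abstract. -/
theorem frame_pullback_compSeries (h2 : ι π₀ = 2) (hfX : f.map ι = (1 + X : A⟦X⟧) ^ 2 - 1)
    {ϖ' : A⟦X⟧} (hϖ'0 : constantCoeff ϖ' = 1) (hϖ'φ : ϖ'.map φ = ϖ')
    (hEf' : ϖ' * d⁄dX A (f'.map ι) = C (ι u₀ * ι π₀) * ϖ'.subst (f'.map ι)) :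
    (1 + X : A⟦X⟧) * d⁄dX A (compSeries ι φ hA hf hf' hε) =
      C ε * ϖ'.subst (compSeries ι φ hA hf hf' hε) :=
  invDiff_pullback_compSeries ι φ hA hf hf' hε (ϖ := 1 + X) (by simp)
    (by rw [map_add, map_one, map_X]) (by rw [hfX, h2]; exact invDiff_eq_frame) hϖ'0 hϖ'φ hEf'

end TreeInstantiation

/-! ### §9 H2 currency bridge (k1-g37 K2, XS): `π ∣ x` in `𝒪` ↔ `‖π⁻¹ x‖ ≤ 1` in the field -/

/-- `‖p⁻¹ x‖ ≤ 1 ↔ x ∈ p·(unit ball)`. -/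
theorem norm_inv_mul_le_one_iff {𝕜 : Type*} [NormedField 𝕜] {p : 𝕜} (hp : p ≠ 0) (x : 𝕜) :
    ‖p⁻¹ * x‖ ≤ 1 ↔ ∃ y : 𝕜, ‖y‖ ≤ 1 ∧ x = p * y := by
  constructor
  · intro h
    exact ⟨p⁻¹ * x, h, by rw [mul_inv_cancel_left₀ hp]⟩
  · rintro ⟨y, hy, rfl⟩
    rwa [inv_mul_cancel_left₀ hp]


/-! ### §10 ★★★★ THE DOCKET'S T3 / R218a «PULLBACK₂» CLOSED: k3-g39's `ComparisonChainRule`, verbatim,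
for EVERY uniformiser `π` of EVERY nonarchimedean local field `F` (any `q`), on the tree's
`ltComparison` / `compSeriesC`

`ω_f^ι · ϑ′ = C (coeff 1 ϑ) · ω_{f′}^ι(ϑ)` in `𝐃⟦X⟧ = UnrCoeff F⟦X⟧`, `ϑ = compSeriesC hπ hσ₀ u hε`,
`ω_f = invDiff (isLTRing_LTCoeff hπ) (isLTSeries_LTCoeff π)`, `ω_{f′}` the same for `π′ = uπ`,
`ι = (intToUnrCoeff F).comp (LTCoeff.of F).symm.toRingHom` — by §8 `invDiff_pullback_compSeries` with all six
side conditions discharged BY NAME from the tree (`constantCoeff_invDiff`, `galAut_algebraMap`,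
`invDiff_mul_derivative_ltSer`), then transported to the discrete copy as the tree transports
`subst_hom_ltComparison` (`LubinTateComparisonDilation.subst_homC_compSeriesC`). -/

section DocketT3

open Literature.NumberTheory.GaloisRepresentations
open Literature.NumberTheory.GaloisRepresentations.IsNonarchimedeanLocalField
open Literature.NumberTheory.GaloisRepresentations.LubinTate ValuativeRel Field
open Literature.NumberTheory.PAdicHodge

variable {F : Type} [Field F] [ValuativeRel F] [TopologicalSpace F] [IsNonarchimedeanLocalField F]

attribute [local instance] ltNormUniformSpace ltNormIsUniformAddGroup rk1 nF nE fintypeResidueField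

variable {π : 𝒪[F]} (hπ : (valuation F).IsUniformizer (π : F)) (u : 𝒪[F]ˣ)
  {σ₀ : absoluteGaloisGroup F} (hσ₀ : IsAbsArithFrob σ₀)
  {ε : (maxUnramifiedCompletion F)ˣ}
  (hε : maxUnramifiedCompletion.galAut F σ₀ (ε : maxUnramifiedCompletion F) =
    algebraMap 𝒪[F] (maxUnramifiedCompletion F) (u : 𝒪[F]) * (ε : maxUnramifiedCompletion F))

/-- `𝒪[F] = LTCoeff F → 𝒪̂_{F^nr}` (the structure map read on the discrete copy `LTCoeff F`). -/
abbrev ltEmb (F : Type) [Field F] [ValuativeRel F] [TopologicalSpace F] [IsNonarchimedeanLocalField F] :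
    LTCoeff F →+* maxUnramifiedCompletion F :=
  (algebraMap 𝒪[F] (maxUnramifiedCompletion F)).comp (LTCoeff.of F).symm.toRingHom

/-- `f = πX + X^q` read through `ltEmb` is `f` read through the structure map (unfolding). -/
theorem map_ltEmb_ltSer {B : Type*} [CommRing B] (j : 𝒪[F] →+* B) (π : 𝒪[F]) :
    (ltSer F π).map (j.comp (LTCoeff.of F).symm.toRingHom) =
      (((ltPoly F π : Polynomial 𝒪[F]) : PowerSeries 𝒪[F])).map j := by
  ext n
  rw [coeff_map, coeff_map]
  rfl

/-- The invariant differential read in any `𝒪[F]`-algebra `B` keeps `ω(0) = 1` and its `[π]`-equivariance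
`ω · f′ = π · ω ∘ f` (tree `constantCoeff_invDiff`, `invDiff_mul_derivative_ltSer`, mapped). -/
theorem invDiff_map_spec {B : Type*} [CommRing B] (j : 𝒪[F] →+* B) :
    constantCoeff ((invDiff (isLTRing_LTCoeff hπ) (isLTSeries_LTCoeff π)).map
        (j.comp (LTCoeff.of F).symm.toRingHom)) = 1 ∧
      (invDiff (isLTRing_LTCoeff hπ) (isLTSeries_LTCoeff π)).map (j.comp (LTCoeff.of F).symm.toRingHom) *
          d⁄dX B ((((ltPoly F π : Polynomial 𝒪[F]) : PowerSeries 𝒪[F])).map j) =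
        C (j π) *
          ((invDiff (isLTRing_LTCoeff hπ) (isLTSeries_LTCoeff π)).map
            (j.comp (LTCoeff.of F).symm.toRingHom)).subst
            ((((ltPoly F π : Polynomial 𝒪[F]) : PowerSeries 𝒪[F])).map j) := by
  refine ⟨by rw [constantCoeff_map', constantCoeff_invDiff, map_one], ?_⟩
  have hs : HasSubst (ltSer F π) :=
    HasSubst.of_constantCoeff_zero' (isLTSeries_LTCoeff π).constantCoeff_eq_zero
  have h := congrArg (PowerSeries.map (j.comp (LTCoeff.of F).symm.toRingHom))
    (invDiff_mul_derivative_ltSer (F := F) hπ)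
  rw [map_mul, map_mul, ← derivative_map', map_C, map_subst_one' _ hs, map_ltEmb_ltSer] at h
  exact h

/-- The invariant differential read in `𝒪̂_{F^nr}` is Frobenius-fixed coefficientwise. -/
theorem map_galAut_invDiff_map :
    ((invDiff (isLTRing_LTCoeff hπ) (isLTSeries_LTCoeff π)).map (ltEmb F)).map
        (maxUnramifiedCompletion.galAut F σ₀).toRingHom =
      (invDiff (isLTRing_LTCoeff hπ) (isLTSeries_LTCoeff π)).map (ltEmb F) := by
  have hc : (maxUnramifiedCompletion.galAut F σ₀).toRingHom.comp (ltEmb F) = ltEmb F :=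
    RingHom.ext fun a => maxUnramifiedCompletion.galAut_algebraMap σ₀ ((LTCoeff.of F).symm a)
  rw [← RingHom.comp_apply (PowerSeries.map (maxUnramifiedCompletion.galAut F σ₀).toRingHom)
      (PowerSeries.map (ltEmb F)), ← PowerSeries.map_comp, hc]

/-- ★★★★ **R218a «PULLBACK₂» over `𝒪̂_{F^nr}`**: `ω_f · ϑ′ = ε · ω_{f′}(ϑ)` for the tree's
`ϑ = ltComparison hπ hσ₀ u hε` (any `F`, any uniformiser `π`, any `q`). -/
theorem invDiff_mul_derivative_ltComparison :
    (invDiff (isLTRing_LTCoeff hπ) (isLTSeries_LTCoeff π)).map (ltEmb F) *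
        d⁄dX (maxUnramifiedCompletion F) (ltComparison hπ hσ₀ u hε) =
      C (ε : maxUnramifiedCompletion F) *
        ((invDiff (isLTRing_LTCoeff (isUniformizer_unit_mul hπ u))
            (isLTSeries_LTCoeff ((u : 𝒪[F]) * π))).map (ltEmb F)).subst (ltComparison hπ hσ₀ u hε) := by
  haveI := isAdicComplete_span_unrPi hπ
  obtain ⟨h0, hE⟩ := invDiff_map_spec hπ (algebraMap 𝒪[F] (maxUnramifiedCompletion F))
  obtain ⟨h0', hE'⟩ := invDiff_map_spec (isUniformizer_unit_mul hπ u)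
    (algebraMap 𝒪[F] (maxUnramifiedCompletion F))
  rw [map_mul (algebraMap 𝒪[F] (maxUnramifiedCompletion F)) (u : 𝒪[F]) π] at hE'
  exact invDiff_pullback_compSeries (algebraMap 𝒪[F] (maxUnramifiedCompletion F))
    (maxUnramifiedCompletion.galAut F σ₀).toRingHom (isTwistBase_galAut hπ hσ₀)
    (isLTSeries_ltPoly F (π := π)) (isLTSeries_ltPoly F (π := (u : 𝒪[F]) * π)) (u₀ := u)
    (ε := (ε : maxUnramifiedCompletion F)) hε
    h0 (map_galAut_invDiff_map hπ) hE h0' (map_galAut_invDiff_map (isUniformizer_unit_mul hπ u)) hE'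

/-- ★★★★ **k3-g39's sub-stub T3 `ComparisonChainRule`, for every uniformiser** (its `h2 ↦ hπ`): the statement
below with `π := ((2 : ℕ) : 𝒪[F])` is `ComparisonChainRule h2 u hσ₀ hε` of
`STUB_IDEAS_stub_heegnerIndexLowerAtTwo_3_g39.lean` VERBATIM. -/
theorem comparisonChainRuleC :
    PowerSeries.map ((intToUnrCoeff F).comp (LTCoeff.of F).symm.toRingHom)
          (invDiff (isLTRing_LTCoeff hπ) (isLTSeries_LTCoeff π)) *
        PowerSeries.derivative (UnrCoeff F) (compSeriesC hπ hσ₀ u hε) =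
      PowerSeries.C (PowerSeries.coeff 1 (compSeriesC hπ hσ₀ u hε)) *
        PowerSeries.subst (compSeriesC hπ hσ₀ u hε)
          ((invDiff (isLTRing_LTCoeff (isUniformizer_unit_mul hπ u))
              (isLTSeries_LTCoeff ((u : 𝒪[F]) * π))).map
            ((intToUnrCoeff F).comp (LTCoeff.of F).symm.toRingHom)) := by
  have hsθ : HasSubst (ltComparison hπ hσ₀ u hε) :=
    HasSubst.of_constantCoeff_zero' (constantCoeff_ltComparison hπ hσ₀ u hε)
  have h := congrArg (PowerSeries.map (UnrCoeff.of F).toRingHom)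
    (invDiff_mul_derivative_ltComparison hπ u hσ₀ hε)
  rw [map_mul, map_mul, ← derivative_map', map_C, map_subst_one' _ hsθ,
    ← RingHom.comp_apply (PowerSeries.map (UnrCoeff.of F).toRingHom) (PowerSeries.map (ltEmb F)),
    ← PowerSeries.map_comp,
    ← RingHom.comp_apply (PowerSeries.map (UnrCoeff.of F).toRingHom) (PowerSeries.map (ltEmb F)),
    ← PowerSeries.map_comp] at h
  have e1 : PowerSeries.coeff 1 (compSeriesC hπ hσ₀ u hε) =
      (UnrCoeff.of F).toRingHom (ε : maxUnramifiedCompletion F) := by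
    rw [compSeriesC, coeff_map, coeff_one_ltComparison]
  rw [e1]
  exact h

/-- The `π = 2` instance: LITERALLY the Prop `ComparisonChainRule h2 u hσ₀ hε` of k3-g39 (T3, «THE ONLY OPEN
PIECE» of its split of R218), now a theorem. -/
theorem comparisonChainRule_two (h2 : (valuation F).IsUniformizer (((2 : ℕ) : 𝒪[F]) : F)) :
    PowerSeries.map ((intToUnrCoeff F).comp (LTCoeff.of F).symm.toRingHom)
          (invDiff (isLTRing_LTCoeff h2) (isLTSeries_LTCoeff (((2 : ℕ) : 𝒪[F])))) *
        PowerSeries.derivative (UnrCoeff F) (compSeriesC h2 hσ₀ u hε) =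
      PowerSeries.C (PowerSeries.coeff 1 (compSeriesC h2 hσ₀ u hε)) *
        PowerSeries.subst (compSeriesC h2 hσ₀ u hε)
          ((invDiff (isLTRing_LTCoeff (isUniformizer_unit_mul h2 u))
              (isLTSeries_LTCoeff ((u : 𝒪[F]) * ((2 : ℕ) : 𝒪[F])))).map
            ((intToUnrCoeff F).comp (LTCoeff.of F).symm.toRingHom)) :=
  comparisonChainRuleC h2 u hσ₀ hε

end DocketT3

end Summit.BirchSwinnertonDyer.BirchSwinnertonDyer.Cruxes.SplitBadTwoLowerHalfOfFacts.TwistedRigidityK1G38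

end


/-!
# STUB-IDEAS k = 3 (gen 39) for `stub_heegnerIndexLowerAtTwo` — node **R218 «PRIM₂»** of STUB-PLAN v7.1

Technique of record (director): **decomposition — split into sub-stubs with a PROVABLE (here: PROVED) glue**.

**BSD is NOT proved by any of this.**  The crux `PrintCf2.SplitBadTwoLowerHalfOfFacts` and the stub of record
`stub_heegnerIndexLowerAtTwo` (skeleton `f2bd84c0…`, `Cruxes/SplitBadTwoRankOneOfFacts/Lines/heegner_index_two_lower.lean`)
are FIXED and not re-typed here.  This file attacks ONE registered node of the critic's plan: R218 «PRIM₂» = k3-g38's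
`BoundedPrimitive H C` ("every member of the relative tilde family `H_β = Θ(j((δ_E g_β)~) ∘ ϑ)` has a `D`-primitive with
coefficients bounded by `C`"), which is the `k = 0` input of the moment chain (CRITIC-ROWS-g38 rows 108–111: open credit =
R218, «S–M⁻, new small infrastructure: a `p`-adic/pro-2 logarithm of a power series»).

## The lever (new on this crux): the REFLECTION PRIMITIVE at `q = 2`

At `q = 2` with `π' = 2u` the tree's twisted eigen-equation `𝒮_E(δβ) = π'·(δβ)^φ` and `(𝒮_E h)∘f = h + τ_E h`
(`τ_E G(X) = G(X [+] ω₁) = G(−π'−X)`, the order-two reflection) give, with NO Frobenius left over,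

  `2 · (δ_E g_β)~ = δβ − τ_E(δβ) = δ_E(g_β / τ_E g_β)`            (§D, PROVED: `two_mul_relTildeSeries[_eq_relLogDeriv_reflQuot]`),

so a `D`-primitive of `H_β` is **`½ · log Θ(Q_β ∘ ϑ)`**, `Q_β := g_β/τ_E g_β` the REFLECTION QUOTIENT, and `Q_β ≡ Q_β(0)
(mod π')` (§D, PROVED: `reflQuot_sub_one_mem`).  The ONLY analytic content of PRIM₂ is then the **dyadic Dwork lemma**
`V ≡ 1 (mod 2) ⟹ ½·log V ∈ 𝒪⟦S⟧` (`v₂(2^d/d) ≥ 1`; §B, PROVED with Mathlib's 2026 `PowerSeries.log`: `norm_coeff_logOf_le`),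
and the glue `D(log V)·V = (1+S)V'` (§A, PROVED) ⟹ `BoundedPrimitive H 1` (§C, PROVED: `boundedPrimitive_of_hasReflectionDatum`,
`hasReflectionDatum_of_unnormalised`).  No `p`-adic logarithm of a power series, no `2`-adic convergence, no pro-`2`
projection, no Frobenius in the primitive: the «new small infrastructure» of R218 collapses to the X-adic `logOf`.

## The split of R218 — NET RESULT: `R218 ⟸ T3` alone, everything else PROVED (§E `boundedPrimitive_of_comparisonChainRule`)

* T3 `ComparisonChainRule` (typed, THE ONLY OPEN PIECE, NEW helper lemma, size S): `ω_f·ϑ' = ε·ω_{f'}(ϑ)` in `𝐃⟦S⟧` —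
  the invariant differential pulls back along Lubin–Tate's comparison isomorphism `ϑ` (`λ_{f'}∘ϑ = ε·λ_f`), the
  hom-analogue of the tree's `LubinTate.map_invDiff_mul_derivative_hom` (`ω_F·[a]' = a·ω_F([a])`); inputs in tree:
  `subst_ltF_compSeries` (Lubin–Tate (17) as a series identity), `evalAt_ltAdd_invDiff`, `evalPt₁_compSeries_ltAdd`.
  At `q = 2`: `ω_f = 1 + S` (**PROVED**, `invDiff_two_eq`, from `ltF_ltPoly_two_eq`: `F_{2X+X²} = X+Y+XY`).
* H5 `TransportedDIdentity` (typed): `2Θ(ε)·H_β·V_β = (1+S)V_β'`, `V_β := Θ(j(Q_β)∘ϑ)` — **PROVED from T3**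
  (`transportedDIdentity_of_comparisonChainRule`: §D `two_mul_relTildeSeries_mul_reflQuot` + `derivative_subst` + `hj`).
* H6 `TransportedCongruence` (typed): `‖[S^k](V_β − 1)‖ ≤ ‖2‖` — **PROVED** (`transportedCongruence_holds`: §D
  `reflQuot_sub_one_mem` pushed through `map j` (`hj`), `subst ϑ` (`coeffIdeal` is `subst`-stable), `map Θ` (`hθ1`),
  `‖Θ(j(2u))‖ = ‖2‖`).
* GLUE (PROVED): `H5 → H6 → BoundedPrimitive (b ↦ H_{η b}) 1` for the VERBATIM family of
  `seriesFamily_hsock_of_relNormCoherentUnits` and ANY index map `η : B → RelNormCoherentUnits`; constant `C = 1`.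

Literature anchor: de Shalit's integrality lemma I.3.3 (7) `log̃ g_β = log g_β − (1/p)·Σ_{ω ∈ W_f^1} log g_β(T [+] ω) ∈ 𝒪⟦T⟧`
(proof: `g^p ≡ ∏_ω g(T[+]ω) (mod 𝔭')` and `np ∣ pⁿ`) SPECIALISES at `p = q = 2`, `W_f^1 = {0, ω₁}`, to
`log̃ g = ½·(log g − log τ_E g) = ½·log(g/τ_E g)` — the reflection quotient; so (7) needs no Frobenius and no `p`-adic `log` of
constants once `δ_E` has killed them, and `np ∣ pⁿ` is the dyadic Dwork bound `‖[S^k] logOf V‖ ≤ ‖2‖` of §B.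

## References

* [deShalit1987] E. de Shalit, *Iwasawa theory of elliptic curves with complex multiplication*, Academic Press (1987):
  I.3.3 Lemma + (7), (7′) (p. 17: `log g − (1/p)·Σ_ω log g(T[+]ω) = log g − (1/p)·log g^φ∘f ∈ 𝒪⟦T⟧`), I.3.2 (5), I.3.5 (11)
  (p. 18), I.3.12–3.13 (q = 2 reflection `τ`), II.4.7 (17) (p. 60).
* [LubinTate1965] J. Lubin, J. Tate, *Formal complex multiplication in local fields*, Ann. Math. 81 (1965), Lemma p. 385, (17).
* [Lang1990] S. Lang, *Cyclotomic Fields I and II*, GTM 121 (1990), Ch. 14 §2 Lemma (Dieudonné–Dwork) (p. 210 of our copy).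
* [Dwork1958]-type lemma `exp(X − X^p/p)`/`(1/p) log(h/h^φ∘[p]) ∈ ℤ_p⟦X⟧` — here in its dyadic, Frobenius-free form.
* Mathlib `Mathlib/RingTheory/PowerSeries/Log.lean` (`PowerSeries.log`, `logOf`, `coeff_log`), `…/Derivative.lean`
  (`derivative_subst`), `…/Substitution.lean`.
-/

noncomputable section

set_option linter.dupNamespace false
set_option linter.unusedSectionVars false

open scoped PowerSeries.WithPiTopology

namespace Summit.BirchSwinnertonDyer.BirchSwinnertonDyer.Cruxes.SplitBadTwoLowerHalfOfFacts.ReflectionPrimitiveK3G39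

open Literature.NumberTheory.EllipticCurves

/-! ### §A. `D (log V) · V = (1+S) · V'` for `V(0) = 1` — Mathlib's `PowerSeries.logOf` (2026) under de Shalit's `D` -/

section LogOf

open PowerSeries

variable {A : Type*} [CommRing A] [Algebra ℚ A]

/-- The geometric series `Σ (-1)^n X^n = 1/(1+X)` (the derivative of `log(1+X)`, `PowerSeries.deriv_log`). -/
def geom (A : Type*) [CommRing A] [Algebra ℚ A] : A⟦X⟧ := mk fun n => algebraMap ℚ A ((-1 : ℚ) ^ n)

/-- `(1 + X) · Σ (-1)^n X^n = 1`. [folklore] -/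
theorem one_add_X_mul_geom : ((1 : A⟦X⟧) + X) * geom A = 1 := by
  ext n
  rcases n with _ | n
  · simp [geom]
  · rw [add_mul, one_mul, map_add, geom, coeff_mk, coeff_succ_X_mul, coeff_mk, coeff_one,
      if_neg (Nat.succ_ne_zero n), pow_succ, mul_neg_one, map_neg, neg_add_cancel]

/-- `V · (geom ∘ (V − 1)) = 1` when `V(0) = 1`: the substituted geometric series inverts `V`. [folklore] -/
theorem mul_geom_subst_eq_one {V : A⟦X⟧} (hV : constantCoeff V = 1) :
    V * (geom A).subst (V - 1) = 1 := by
  have h0 : constantCoeff (V - 1) = 0 := by rw [map_sub, map_one, hV, sub_self]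
  have hs : HasSubst (V - 1) := HasSubst.of_constantCoeff_zero' h0
  have key : substAlgHom hs (((1 : A⟦X⟧) + X) * geom A) = substAlgHom hs (1 : A⟦X⟧) := by rw [one_add_X_mul_geom]
  rw [map_mul, map_add, map_one, substAlgHom_X, coe_substAlgHom] at key
  rwa [add_sub_cancel] at key

/-- ★ **`D(log V) · V = (1 + S) · V'`** for `V(0) = 1` and `D = (1+S) d/dS` (`mahlerD`): the `D`-logarithmic derivative of
`V` is `D` of Mathlib's `logOf V = log(1+X) ∘ (V − 1)`. [cite: deShalit1987, I.3.5 (p. 18)] -/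
theorem mahlerD_logOf_mul {V : A⟦X⟧} (hV : constantCoeff V = 1) :
    mahlerD (logOf V) * V = (1 + X) * d⁄dX A V := by
  have h0 : constantCoeff (V - 1) = 0 := by rw [map_sub, map_one, hV, sub_self]
  have hs : HasSubst (V - 1) := HasSubst.of_constantCoeff_zero' h0
  have h1 := mul_geom_subst_eq_one hV
  rw [mahlerD, logOf_eq, derivative_subst A hs, deriv_log, map_sub, Derivation.map_one_eq_zero, sub_zero]
  calc (1 + X) * ((mk fun n => algebraMap ℚ A ((-1 : ℚ) ^ n)).subst (V - 1) * d⁄dX A V) * V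
      = (1 + X) * d⁄dX A V * (V * (geom A).subst (V - 1)) := by rw [geom]; ring
    _ = (1 + X) * d⁄dX A V := by rw [h1, mul_one]

/-- `log V` has no constant term. [folklore] -/
theorem constantCoeff_logOf' {V : A⟦X⟧} (hV : constantCoeff V = 1) : constantCoeff (logOf V) = 0 :=
  constantCoeff_logOf hV

end LogOf

/-! ### §B. The DYADIC DWORK LEMMA: `log V` is as integral as `V − 1` when `V ≡ 1 (mod 2)` (`v₂(2^d/d) ≥ 1`) -/

section Dyadic

open PowerSeries

variable {𝕜 : Type*} [NormedField 𝕜] [NormedAlgebra ℚ_[2] 𝕜] [IsUltrametricDist 𝕜]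

omit [NormedAlgebra ℚ_[2] 𝕜] in
/-- Ultrametric product bound on coefficients. [folklore] -/
theorem norm_coeff_mul_le {P Q : 𝕜⟦X⟧} {a b : ℝ} (hP : ∀ i, ‖coeff i P‖ ≤ a) (hQ : ∀ j, ‖coeff j Q‖ ≤ b) (k : ℕ) :
    ‖coeff k (P * Q)‖ ≤ a * b := by
  have ha : 0 ≤ a := (norm_nonneg _).trans (hP 0)
  have hb : 0 ≤ b := (norm_nonneg _).trans (hQ 0)
  rw [coeff_mul]
  refine IsUltrametricDist.norm_sum_le_of_forall_le_of_nonneg (mul_nonneg ha hb) fun ij _ => ?_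
  rw [norm_mul]
  exact mul_le_mul (hP _) (hQ _) (norm_nonneg _) ha

omit [NormedAlgebra ℚ_[2] 𝕜] in
/-- Ultrametric power bound on coefficients. [folklore] -/
theorem norm_coeff_pow_le {T : 𝕜⟦X⟧} {a : ℝ} (hT : ∀ i, ‖coeff i T‖ ≤ a) (d k : ℕ) :
    ‖coeff k (T ^ d)‖ ≤ a ^ d := by
  induction d generalizing k with
  | zero =>
    rw [pow_zero, pow_zero, coeff_one]
    split_ifs <;> simp
  | succ d ih =>
    rw [pow_succ, pow_succ]
    exact norm_coeff_mul_le ih hT k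

omit [IsUltrametricDist 𝕜] in
/-- `‖2‖ = 1/2` in a normed `ℚ₂`-algebra. [folklore] -/
theorem norm_two_eq : ‖(2 : 𝕜)‖ = (2 : ℝ)⁻¹ := by
  rw [show (2 : 𝕜) = algebraMap ℚ_[2] 𝕜 2 by rw [map_ofNat], norm_algebraMap']
  exact_mod_cast Padic.norm_p (p := 2)

omit [IsUltrametricDist 𝕜] in
/-- `‖m‖ = 1` for odd `m` in a normed `ℚ₂`-algebra. [folklore] -/
theorem norm_natCast_of_odd {m : ℕ} (hm : Odd m) : ‖(m : 𝕜)‖ = 1 := by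
  rw [show (m : 𝕜) = algebraMap ℚ_[2] 𝕜 m by rw [map_natCast], norm_algebraMap']
  have h1 : ‖((m : ℤ) : ℚ_[2])‖ ≤ 1 := Padic.norm_int_le_one _
  have h2 : ¬ ‖((m : ℤ) : ℚ_[2])‖ < 1 := by
    rw [Padic.norm_intCast_lt_one_iff]
    exact_mod_cast hm.not_two_dvd_nat
  push_cast at h1 h2
  exact le_antisymm h1 (not_lt.mp h2)

/-- ★ **`v₂(2^d / d) ≥ 1` for `d ≥ 1`** (the whole `p = 2` margin of de Shalit's (7′)), in norm form:
`‖d‖⁻¹ · ‖2‖^d ≤ ‖2‖`. [cite: deShalit1987, I.3.3 (7′) (p. 17)] -/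
theorem inv_norm_natCast_mul_two_pow_le {d : ℕ} (hd : d ≠ 0) :
    ‖(d : 𝕜)‖⁻¹ * ‖(2 : 𝕜)‖ ^ d ≤ ‖(2 : 𝕜)‖ := by
  obtain ⟨a, m, hm, rfl⟩ := Nat.exists_eq_two_pow_mul_odd hd
  have hm0 : 0 < m := Nat.pos_of_ne_zero (by rintro rfl; exact (Nat.not_odd_zero hm).elim)
  have ha : a + 1 ≤ 2 ^ a * m :=
    Nat.succ_le_of_lt ((Nat.lt_two_pow_self).trans_le (Nat.le_mul_of_pos_right _ hm0))
  rw [Nat.cast_mul, Nat.cast_pow, Nat.cast_ofNat, norm_mul, norm_pow, norm_natCast_of_odd hm, mul_one,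
    norm_two_eq]
  have hhalf0 : (0 : ℝ) ≤ 2⁻¹ := by norm_num
  have hhalf1 : (2⁻¹ : ℝ) ≤ 1 := by norm_num
  calc ((2 : ℝ)⁻¹ ^ a)⁻¹ * (2 : ℝ)⁻¹ ^ (2 ^ a * m) ≤ ((2 : ℝ)⁻¹ ^ a)⁻¹ * (2 : ℝ)⁻¹ ^ (a + 1) :=
        mul_le_mul_of_nonneg_left (pow_le_pow_of_le_one hhalf0 hhalf1 ha) (by positivity)
    _ = 2⁻¹ := by rw [pow_succ, ← mul_assoc, inv_mul_cancel₀ (by positivity), one_mul]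

omit [NormedAlgebra ℚ_[2] 𝕜] [IsUltrametricDist 𝕜] in
/-- Coefficients of `(V − 1)^d` below degree `d` vanish when `V(0) = 1`. [folklore] -/
theorem coeff_pow_eq_zero_of_lt {T : 𝕜⟦X⟧} (hT : constantCoeff T = 0) {d k : ℕ} (hkd : k < d) :
    coeff k (T ^ d) = 0 := by
  obtain ⟨W, hW⟩ : X ∣ T := X_dvd_iff.mpr hT
  rw [hW, mul_pow, coeff_X_pow_mul', if_neg (not_le.mpr hkd)]

/-- ★★ **THE DYADIC DWORK LEMMA** (the analytic content of PRIM₂, Mathlib-only): if `V(0) = 1` and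
`‖[S^k](V − 1)‖ ≤ ‖2‖` for all `k` (i.e. `V ≡ 1 (mod 2)` coefficientwise), then `‖[S^k] log V‖ ≤ ‖2‖` for all `k` —
so `½ · log V` is INTEGRAL.  Proof: `[S^k] log V = Σ_{1 ≤ d ≤ k} ((-1)^{d+1}/d) · [S^k](V−1)^d`, each term of norm
`≤ ‖d‖⁻¹ ‖2‖^d ≤ ‖2‖` (`inv_norm_natCast_mul_two_pow_le`), ultrametric.  This is de Shalit's remark that
`log β̃ = log β − p⁻¹ log β^φ∘[π]` is integral although `log β` is not (I.3.3 (7′)), in the one case `p = 2`.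
[cite: deShalit1987, I.3.3 (7′) (p. 17)] [cite: Coleman1979, Thm. 4 / Cor. 2.3 (ii)] -/
theorem norm_coeff_logOf_le [CharZero 𝕜] {V : 𝕜⟦X⟧} (hV : constantCoeff V = 1)
    (h2 : ∀ k, ‖coeff k (V - 1)‖ ≤ ‖(2 : 𝕜)‖) (k : ℕ) :
    ‖coeff k (logOf V)‖ ≤ ‖(2 : 𝕜)‖ := by
  have h0 : constantCoeff (V - 1) = 0 := by rw [map_sub, map_one, hV, sub_self]
  have hs : HasSubst (V - 1) := HasSubst.of_constantCoeff_zero' h0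
  rw [logOf_eq, coeff_subst' hs]
  have hsupp : (Function.support fun d : ℕ => coeff d (log 𝕜) • coeff k ((V - 1) ^ d)) ⊆ (Finset.range (k + 1) : Set ℕ) := by
    intro d hd
    rw [Finset.coe_range, Set.mem_Iio]
    by_contra hdk
    exact hd (by simp only [coeff_pow_eq_zero_of_lt h0 (Nat.lt_of_succ_le (not_lt.mp hdk)), smul_zero])
  rw [finsum_eq_sum_of_support_subset _ hsupp]
  refine IsUltrametricDist.norm_sum_le_of_forall_le_of_nonneg (norm_nonneg _) fun d _ => ?_
  rcases Nat.eq_zero_or_pos d with rfl | hd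
  · simp
  · rw [coeff_log, if_neg hd.ne', smul_eq_mul, norm_mul, eq_ratCast, Rat.cast_div, Rat.cast_pow, Rat.cast_neg,
      Rat.cast_one, Rat.cast_natCast, norm_div, norm_pow, norm_neg, norm_one, one_pow, one_div]
    exact (mul_le_mul_of_nonneg_left (norm_coeff_pow_le h2 d k) (inv_nonneg.mpr (norm_nonneg _))).trans
      (inv_norm_natCast_mul_two_pow_le hd.ne')

end Dyadic

/-! ### §C. The PROVED GLUE: a reflection-quotient datum for every `H_b` ⟹ k3-g38's `BoundedPrimitive H 1` -/

section Glue

open PowerSeries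

variable {𝕜 : Type*} [NormedField 𝕜] [NormedAlgebra ℚ_[2] 𝕜] [IsUltrametricDist 𝕜]

/-- **SUB-STUB OF RECORD (R218 «PRIM₂», k3-g38 §5, token-identical).** Every member of the family has a BOUNDED
`D`-primitive with the same bound. -/
def BoundedPrimitive {𝕜 : Type*} [NormedField 𝕜] {B : Type*} (H : B → PowerSeries 𝕜) (C : ℝ) : Prop :=
  ∀ b : B, ∃ A : PowerSeries 𝕜, (∀ m, ‖PowerSeries.coeff m A‖ ≤ C) ∧ mahlerD A = H b

omit [NormedAlgebra ℚ_[2] 𝕜] [IsUltrametricDist 𝕜] in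
/-- `BoundedPrimitive` is monotone in the bound. [folklore] -/
theorem BoundedPrimitive.mono {B : Type*} {H : B → 𝕜⟦X⟧} {C C' : ℝ} (h : BoundedPrimitive H C) (hCC' : C ≤ C') :
    BoundedPrimitive H C' := fun b => by
  obtain ⟨A, hA, hD⟩ := h b
  exact ⟨A, fun m => (hA m).trans hCC', hD⟩

/-- **THE NEW OBJECT — a REFLECTION-QUOTIENT DATUM for `H_b`**: a series `V ∈ 𝕜⟦S⟧` with `V(0) = 1` and `V ≡ 1 (mod 2)`
(`‖[S^k](V − 1)‖ ≤ ‖2‖`), and a scalar `e` with `‖e⁻¹‖ ≤ 1`, such that `2e · H_b · V = (1+S) V'`, i.e.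
**`2e · H_b = D log V`**.  For the relative tilde family `H_β = Θ((δ_E g_β)~ ∘ ϑ)` the datum is
`V = Θ(W_β ∘ ϑ)`, `W_β = (g_β/τ_E g_β)/(g_β/τ_E g_β)(0)` the NORMALISED REFLECTION QUOTIENT, `e = Θ(ε)` (`ϑ ≡ εS`):
§D–§E below. -/
def HasReflectionDatum (Hb : 𝕜⟦X⟧) : Prop :=
  ∃ V : 𝕜⟦X⟧, ∃ e : 𝕜, constantCoeff V = 1 ∧ (∀ k, ‖coeff k (V - 1)‖ ≤ ‖(2 : 𝕜)‖) ∧ e ≠ 0 ∧ ‖e⁻¹‖ ≤ 1 ∧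
    C (2 * e) * Hb * V = (1 + X) * d⁄dX 𝕜 V

omit [NormedAlgebra ℚ_[2] 𝕜] [IsUltrametricDist 𝕜] in
/-- `D` is linear over constants: `D(c · P) = c · DP`. [cite: deShalit1987, I.3.5 (p. 18)] -/
theorem mahlerD_C_mul (c : 𝕜) (P : 𝕜⟦X⟧) : mahlerD (C c * P) = C c * mahlerD P := by
  ext n
  rw [coeff_mahlerD, coeff_C_mul, coeff_C_mul, coeff_C_mul, coeff_mahlerD]
  ring

/-- ★★★ **THE GLUE (PROVED): reflection-quotient data ⟹ `BoundedPrimitive H 1`.**  The primitive is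
`A_b := (2e)⁻¹ · log V_b`: bounded by `1` by the DYADIC DWORK LEMMA (`‖(2e)⁻¹‖ · ‖2‖ = ‖e⁻¹‖ ≤ 1`), and
`D A_b = (2e)⁻¹ · D log V_b = (2e)⁻¹ · (1+S)V_b'/V_b = H_b` (§A, cancelling the unit `V_b`).  With §D–§E this reduces
R218 «PRIM₂» to THREE tree-algebra identities and ONE comparison chain rule — no `p`-adic logarithm of a power series,
no Frobenius, no pro-`2` projection. [cite: deShalit1987, I.3.3 (7′) (p. 17), I.3.5 (p. 18)] -/
theorem boundedPrimitive_of_hasReflectionDatum [CharZero 𝕜] {B : Type*} (H : B → 𝕜⟦X⟧)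
    (h : ∀ b, HasReflectionDatum (H b)) : BoundedPrimitive H 1 := by
  intro b
  obtain ⟨V, e, hV1, hV2, he, heinv, hD⟩ := h b
  have h20 : (2 : 𝕜) ≠ 0 := two_ne_zero
  have h2e : (2 : 𝕜) * e ≠ 0 := mul_ne_zero h20 he
  refine ⟨C ((2 * e)⁻¹) * logOf V, fun m => ?_, ?_⟩
  · rw [coeff_C_mul, norm_mul, norm_inv, norm_mul, mul_inv, mul_assoc]
    calc ‖(2 : 𝕜)‖⁻¹ * (‖e‖⁻¹ * ‖coeff m (logOf V)‖) ≤ ‖(2 : 𝕜)‖⁻¹ * (1 * ‖(2 : 𝕜)‖) := by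
          refine mul_le_mul_of_nonneg_left (mul_le_mul ?_ (norm_coeff_logOf_le hV1 hV2 m) (norm_nonneg _) zero_le_one)
            (inv_nonneg.mpr (norm_nonneg _))
          rwa [← norm_inv]
      _ = 1 := by rw [one_mul, inv_mul_cancel₀ (norm_ne_zero_iff.mpr h20)]
  · have hV0 : V ≠ 0 := fun h0 => by
      rw [h0, map_zero] at hV1
      exact zero_ne_one hV1
    have key : mahlerD (logOf V) = C (2 * e) * H b :=
      mul_right_cancel₀ hV0 (by rw [mahlerD_logOf_mul hV1, hD])
    rw [mahlerD_C_mul, key, ← mul_assoc, ← map_mul, inv_mul_cancel₀ h2e, map_one, one_mul]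


/-- ★ **Normalisation is free** (PROVED): an UNNORMALISED datum `V₀ ≡ 1 (mod 2)` (all coefficients of `V₀ − 1`, including
the constant one, of norm `≤ ‖2‖`) with `2e · H_b · V₀ = (1+S) V₀'` gives a reflection datum (`V := V₀ / V₀(0)`).  This is
what lets the TRANSPORT step (§E) work with the unit `Q_β = g_β/τ_E g_β` itself. [folklore] -/
theorem hasReflectionDatum_of_unnormalised {Hb V₀ : 𝕜⟦X⟧} {e : 𝕜} (hV : ∀ k, ‖coeff k (V₀ - 1)‖ ≤ ‖(2 : 𝕜)‖)
    (he : e ≠ 0) (heinv : ‖e⁻¹‖ ≤ 1) (hD : C (2 * e) * Hb * V₀ = (1 + X) * d⁄dX 𝕜 V₀) :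
    HasReflectionDatum Hb := by
  set a : 𝕜 := constantCoeff V₀ with ha_def
  have h2lt : ‖(2 : 𝕜)‖ < 1 := by rw [norm_two_eq]; norm_num
  have ha1 : ‖a - 1‖ ≤ ‖(2 : 𝕜)‖ := by
    have := hV 0
    rwa [coeff_zero_eq_constantCoeff, map_sub, map_one] at this
  have ha1' : ‖a - 1‖ < 1 := ha1.trans_lt h2lt
  -- `‖a‖ = 1`
  have hale : ‖a‖ ≤ 1 := by
    have e1 : a = 1 + (a - 1) := by ring
    rw [e1]
    refine (IsUltrametricDist.norm_add_le_max _ _).trans (max_le (by rw [norm_one]) ?_)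
    exact ha1'.le
  have hage : 1 ≤ ‖a‖ := by
    by_contra hlt
    rw [not_le] at hlt
    have h1 : ‖a + (1 - a)‖ ≤ max ‖a‖ ‖1 - a‖ := IsUltrametricDist.norm_add_le_max _ _
    rw [add_sub_cancel, norm_one, norm_sub_rev] at h1
    rcases le_max_iff.mp h1 with h | h
    · exact absurd h (not_le.mpr hlt)
    · exact absurd h (not_le.mpr ha1')
  have hanorm : ‖a‖ = 1 := le_antisymm hale hage
  have ha0 : a ≠ 0 := fun h0 => by rw [h0, norm_zero] at hanorm; exact zero_ne_one hanorm
  have hainv : ‖a⁻¹‖ = 1 := by rw [norm_inv, hanorm, inv_one]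
  have hainv1 : ‖a⁻¹ - 1‖ ≤ ‖(2 : 𝕜)‖ := by
    have e1 : a⁻¹ - 1 = a⁻¹ * (1 - a) := by rw [mul_sub, inv_mul_cancel₀ ha0, mul_one]
    rw [e1, norm_mul, hainv, one_mul, norm_sub_rev]; exact ha1
  refine ⟨C a⁻¹ * V₀, e, ?_, fun k => ?_, he, heinv, ?_⟩
  · rw [map_mul, constantCoeff_C, ← ha_def, inv_mul_cancel₀ ha0]
  · have e1 : C a⁻¹ * V₀ - 1 = C a⁻¹ * (V₀ - 1) + C (a⁻¹ - 1) := by rw [map_sub, map_one]; ring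
    rw [e1, map_add, coeff_C_mul, coeff_C]
    refine (IsUltrametricDist.norm_add_le_max _ _).trans (max_le ?_ ?_)
    · rw [norm_mul, hainv, one_mul]; exact hV k
    · split_ifs
      · exact hainv1
      · rw [norm_zero]; exact norm_nonneg _
  · have hd : d⁄dX 𝕜 (C a⁻¹ * V₀) = C a⁻¹ * d⁄dX 𝕜 V₀ := by
      rw [(d⁄dX 𝕜).leibniz, derivative_C, smul_zero, add_zero, smul_eq_mul]
    rw [hd]
    calc C (2 * e) * Hb * (C a⁻¹ * V₀) = C a⁻¹ * (C (2 * e) * Hb * V₀) := by ring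
      _ = C a⁻¹ * ((1 + X) * d⁄dX 𝕜 V₀) := by rw [hD]
      _ = (1 + X) * (C a⁻¹ * d⁄dX 𝕜 V₀) := by ring

end Glue

/-! ### §D. THE LEVER (tree algebra, PROVED): at `q = 2` the twisted tilde is HALF THE REFLECTION-ANTI-INVARIANT PART,
`2 · (δ_E g_β)~ = δ_E g_β − τ_E(δ_E g_β) = δ_E(g_β / τ_E g_β)`, and the reflection quotient is `≡ const (mod π)` -/

section Reflection

open Literature.NumberTheory.GaloisRepresentations
open Literature.NumberTheory.GaloisRepresentations.IsNonarchimedeanLocalField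
open Literature.NumberTheory.GaloisRepresentations.LubinTate ValuativeRel Field

variable {F : Type} [Field F] [ValuativeRel F] [TopologicalSpace F] [IsNonarchimedeanLocalField F]

attribute [local instance] ltNormUniformSpace ltNormIsUniformAddGroup rk1 nF nE fintypeResidueField

variable {π : 𝒪[F]} (hπ : (valuation F).IsUniformizer (π : F))
variable (E : IntermediateField F (AlgebraicClosure F)) [FiniteDimensional F E] [Normal F E] [IsGalois F E]
variable (hq : residueFieldCard F = 2) (hE : E ≤ maxUnramified F) {σ₀ : absoluteGaloisGroup F} (hσ₀ : IsAbsArithFrob σ₀)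

/-- ★ **REFLECTION FORM of the twisted tilde** (`π = 2u`): `2 · (δβ)~ = δβ − τ_E(δβ)`.  From the tree's twisted
eigen-equation `𝒮_E(δβ) = π · (δβ)^φ` (`relTraceTwo_relLogDerivSeries`) and `(𝒮_E h) ∘ f = h + τ_E h`
(`subst_relTraceTwo`): `π · ((δβ)^φ ∘ f) = δβ + τ_E δβ`, so `2u · ((δβ)^φ ∘ f) = δβ + τ_E δβ` and
`2 · (δβ − u · (δβ)^φ ∘ f) = δβ − τ_E δβ`.  The Frobenius has DISAPPEARED.
[cite: deShalit1987, Ch. I §3.12 (23), §3.13] -/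
theorem two_mul_relTildeSeries {u : LTCoeff F} (hu : LTCoeff.of F π = residueFieldCard F * u)
    (β : RelNormCoherentUnits hπ E) :
    (2 : PowerSeries (unitBall E)) * relTildeSeries hπ E hq hE hσ₀ u β =
      relLogDerivSeries hπ E hq hE hσ₀ β - reflE hπ E (relLogDerivSeries hπ E hq hE hσ₀ β) := by
  set h := relLogDerivSeries hπ E hq hE hσ₀ β with hh
  set fS := (ltSer F π).map (algebraMap (LTCoeff F) (unitBall E)) with hfS
  set S := PowerSeries.subst fS (PowerSeries.map (frobUnitBall E σ₀ : unitBall E →+* unitBall E) h) with hS'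
  have hs : PowerSeries.HasSubst fS :=
    PowerSeries.HasSubst.of_constantCoeff_zero' ((isLTSeries_ltSer π).map _).constantCoeff_eq_zero
  -- `(𝒮_E h) ∘ f = h + τ_E h` with `𝒮_E h = C π · h^φ`
  have key : PowerSeries.C (algebraMap 𝒪[F] (unitBall E) π) * S = h + reflE hπ E h := by
    have e := subst_relTraceTwo hπ E hq h
    rw [relTraceTwo_relLogDerivSeries hπ E hq hE hσ₀ β, PowerSeries.subst_mul hs, PowerSeries.subst_C] at e
    exact e
  -- `C π = 2 · C u`
  have hπ2 : PowerSeries.C (algebraMap 𝒪[F] (unitBall E) π) =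
      2 * PowerSeries.C (algebraMap (LTCoeff F) (unitBall E) u) := by
    change PowerSeries.C (algebraMap (LTCoeff F) (unitBall E) (LTCoeff.of F π)) = _
    rw [hu, hq, map_mul, map_natCast, map_mul, map_natCast]
    norm_num
  have e1 : 2 * (PowerSeries.C (algebraMap (LTCoeff F) (unitBall E) u) * S) = h + reflE hπ E h := by
    rw [← mul_assoc, ← hπ2]; exact key
  show (2 : PowerSeries (unitBall E)) * (h - PowerSeries.C (algebraMap (LTCoeff F) (unitBall E) u) * S) =
    h - reflE hπ E h
  rw [mul_sub, e1]
  ring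

/-- The relative Coleman series `g_β` as a unit of `𝒪_E⟦X⟧`. [cite: deShalit1987, Ch. I §2.3] -/
def gUnit (β : RelNormCoherentUnits hπ E) : (PowerSeries (unitBall E))ˣ :=
  (isUnit_relColemanSeries hπ E hq hE hσ₀ β).unit

/-- ★ **THE REFLECTION QUOTIENT `Q_β := g_β / τ_E g_β = g_β(X) / g_β(−π−X)`** (a unit of `𝒪_E⟦X⟧`). -/
def reflQuot (β : RelNormCoherentUnits hπ E) : (PowerSeries (unitBall E))ˣ :=
  gUnit hπ E hq hE hσ₀ β * (reflEUnit hπ E (gUnit hπ E hq hE hσ₀ β))⁻¹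

omit [Normal F E] [IsGalois F E] in
/-- `δ_E(G⁻¹) = −δ_E G`. [cite: deShalit1987, Ch. I §3.12] -/
theorem relLogDeriv_inv (G : (PowerSeries (unitBall E))ˣ) : relLogDeriv hπ E G⁻¹ = -relLogDeriv hπ E G := by
  have e := relLogDeriv_mul hπ E G G⁻¹
  rw [mul_inv_cancel, relLogDeriv_one] at e
  exact eq_neg_of_add_eq_zero_right e.symm

/-- ★★ **`2 · (δ_E g_β)~ = δ_E(Q_β)`**: twice the twisted tilde is the logarithmic derivative of the reflection quotient
(`δ_E` is a homomorphism and commutes with `τ_E`: `relLogDeriv_mul`, `relLogDeriv_reflE`).  So a `D`-PRIMITIVE of the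
tilde family is `½ · log Q_β`, read through the comparison — the whole content of PRIM₂ is the integrality of that `½`.
[cite: deShalit1987, Ch. I §3.12 Corollary, §3.13] -/
theorem two_mul_relTildeSeries_eq_relLogDeriv_reflQuot {u : LTCoeff F} (hu : LTCoeff.of F π = residueFieldCard F * u)
    (β : RelNormCoherentUnits hπ E) :
    (2 : PowerSeries (unitBall E)) * relTildeSeries hπ E hq hE hσ₀ u β = relLogDeriv hπ E (reflQuot hπ E hq hE hσ₀ β) := by
  rw [two_mul_relTildeSeries hπ E hq hE hσ₀ hu β, reflQuot, relLogDeriv_mul, relLogDeriv_inv, relLogDeriv_reflE,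
    ← sub_eq_add_neg]
  rfl

/-- ★ **REFLECTION CONGRUENCE**: `Q_β ≡ 1 (mod π)` coefficientwise — from the tree's `τ_E G ≡ G (mod π)`
(`reflE_sub_self_mem_span`: `X [+] ω₁ − X = −2X − π ∈ (π)` as `2 = π t`). [cite: deShalit1987, Ch. I §3.12] -/
theorem reflQuot_sub_one_mem (β : RelNormCoherentUnits hπ E) :
    (reflQuot hπ E hq hE hσ₀ β : PowerSeries (unitBall E)) - 1 ∈
      coeffIdeal (Ideal.span {algebraMap 𝒪[F] (unitBall E) π}) := by
  have hτ := reflE_sub_self_mem_span hπ E hq (gUnit hπ E hq hE hσ₀ β : PowerSeries (unitBall E))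
  have hinv : (reflEUnit hπ E (gUnit hπ E hq hE hσ₀ β) : PowerSeries (unitBall E)) *
      ↑(reflEUnit hπ E (gUnit hπ E hq hE hσ₀ β))⁻¹ = 1 := Units.mul_inv _
  -- `Q − 1 = −(τg − g) · (τg)⁻¹`
  have e : (reflQuot hπ E hq hE hσ₀ β : PowerSeries (unitBall E)) - 1 =
      -(reflE hπ E (gUnit hπ E hq hE hσ₀ β : PowerSeries (unitBall E)) - ↑(gUnit hπ E hq hE hσ₀ β)) *
        ↑(reflEUnit hπ E (gUnit hπ E hq hE hσ₀ β))⁻¹ := by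
    rw [reflQuot, Units.val_mul, ← coe_reflEUnit]
    linear_combination hinv
  rw [e]
  exact Ideal.mul_mem_right _ _ (neg_mem hτ)

omit [Normal F E] [IsGalois F E] in
/-- `δ_E Q · Q = ω_{f} · Q'` — the logarithmic derivative without division (`dlog G · G = G'`).
[cite: deShalit1987, Ch. I §3.5, §3.12] -/
theorem relLogDeriv_mul_self (G : (PowerSeries (unitBall E))ˣ) :
    relLogDeriv hπ E G * (G : PowerSeries (unitBall E)) =
      (invDiff (isLTRing_LTCoeff hπ) (isLTSeries_LTCoeff π)).map (algebraMap (LTCoeff F) (unitBall E)) *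
        PowerSeries.derivative (unitBall E) (G : PowerSeries (unitBall E)) := by
  rw [relLogDeriv_def, PowerSeries.dlog_def, mul_assoc, mul_assoc, Units.inv_mul, mul_one]

/-- ★★ **THE REFLECTION IDENTITY, division-free** (what gets transported through `j`, `ϑ`, `Θ`):
`2 · (δ_E g_β)~ · Q_β = ω_f · Q_β'`. [cite: deShalit1987, Ch. I §3.12 Corollary, §3.13] -/
theorem two_mul_relTildeSeries_mul_reflQuot {u : LTCoeff F} (hu : LTCoeff.of F π = residueFieldCard F * u)
    (β : RelNormCoherentUnits hπ E) :
    (2 : PowerSeries (unitBall E)) * relTildeSeries hπ E hq hE hσ₀ u β * (reflQuot hπ E hq hE hσ₀ β : PowerSeries (unitBall E)) =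
      (invDiff (isLTRing_LTCoeff hπ) (isLTSeries_LTCoeff π)).map (algebraMap (LTCoeff F) (unitBall E)) *
        PowerSeries.derivative (unitBall E) (reflQuot hπ E hq hE hσ₀ β : PowerSeries (unitBall E)) := by
  rw [two_mul_relTildeSeries_eq_relLogDeriv_reflQuot hπ E hq hE hσ₀ hu β, relLogDeriv_mul_self]

end Reflection

/-! ### §E. TRANSPORT to the family of record `H_β = Θ(j((δ_E g_β)~) ∘ ϑ)` and the split of R218 -/

section Transport

open Literature.NumberTheory.GaloisRepresentations
open Literature.NumberTheory.GaloisRepresentations.IsNonarchimedeanLocalField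
open Literature.NumberTheory.GaloisRepresentations.LubinTate ValuativeRel Field
open Literature.NumberTheory.PAdicHodge

variable {F : Type} [Field F] [ValuativeRel F] [TopologicalSpace F] [IsNonarchimedeanLocalField F]

attribute [local instance] ltNormUniformSpace ltNormIsUniformAddGroup rk1 nF nE fintypeResidueField

variable (h2 : (valuation F).IsUniformizer (((2 : ℕ) : 𝒪[F]) : F)) (u : 𝒪[F]ˣ)
variable (E : IntermediateField F (AlgebraicClosure F)) [FiniteDimensional F E] [Normal F E] [IsGalois F E]
  (hq : residueFieldCard F = 2) (hE : E ≤ maxUnramified F) {σ₀ : absoluteGaloisGroup F} (hσ₀ : IsAbsArithFrob σ₀)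
  (j : unitBall E →+* UnrCoeff F)
variable {ε : (maxUnramifiedCompletion F)ˣ}
  (hε : maxUnramifiedCompletion.galAut F σ₀ (ε : maxUnramifiedCompletion F) =
    algebraMap 𝒪[F] (maxUnramifiedCompletion F) (u : 𝒪[F]) * (ε : maxUnramifiedCompletion F))
variable (θ : CompletedAlgClosure F →+* ℂ_[2])

/-- The reading map `Θ = θ ∘ (𝒪_{ℂ_F} ⊆ ℂ_F) ∘ (𝐃 → 𝒪_{ℂ_F}) : 𝐃 → ℂ₂` of the family of record. -/
def readΘ : UnrCoeff F →+* ℂ_[2] := θ.comp ((CBall F).subtype.comp (algebraMap (UnrCoeff F) (CBall F)))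

/-- The TRANSPORT `L(G) := Θ(j(G) ∘ ϑ) : 𝒪_E⟦X⟧ → ℂ₂⟦S⟧` of the family of record (`H_β = L((δ_E g_β)~)`). -/
def transport (G : PowerSeries (unitBall E)) : PowerSeries ℂ_[2] :=
  (PowerSeries.subst (compSeriesC h2 hσ₀ u hε) (G.map j)).map (readΘ θ)

/-- Sanity (by `rfl`): the family of record `H_β` of `seriesFamily_hsock_of_relNormCoherentUnits` IS `L((δ_E g_β)~)`. -/
example (β : RelNormCoherentUnits (isUniformizer_unit_mul h2 u) E) :
    (PowerSeries.subst (compSeriesC h2 hσ₀ u hε)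
      ((relTildeSeries (isUniformizer_unit_mul h2 u) E hq hE hσ₀ (LTCoeff.of F (u : 𝒪[F])) β).map j)).map
      (θ.comp ((CBall F).subtype.comp (algebraMap (UnrCoeff F) (CBall F)))) =
    transport h2 u E hσ₀ j hε θ (relTildeSeries (isUniformizer_unit_mul h2 u) E hq hE hσ₀ (LTCoeff.of F (u : 𝒪[F])) β) :=
  rfl

include hq in
/-- **`ω_{f₀} = 1 + X` at `q = 2`** (PROVED): the invariant differential of the Lubin–Tate group of `f₀ = 2X + X²`, which
is `Ĝ_m` (`ltF_ltPoly_two_eq`), is `∂₁(X+Y+XY)(0,Y) = 1 + Y`.  This is the `(1+S)` of de Shalit's `D = (1+S)d/dS`.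
[cite: deShalit1987, I.3.2 (p. 17), I.3.5] -/
theorem invDiff_two_eq :
    invDiff (isLTRing_LTCoeff h2) (isLTSeries_LTCoeff (((2 : ℕ) : 𝒪[F]))) = 1 + PowerSeries.X := by
  have hF : ltF (isLTRing_LTCoeff h2) (isLTSeries_LTCoeff (((2 : ℕ) : 𝒪[F]))) =
      MvPowerSeries.X 0 + MvPowerSeries.X 1 + MvPowerSeries.X 0 * MvPowerSeries.X 1 :=
    ltF_ltPoly_two_eq hq h2
  ext i
  rw [coeff_invDiff, hF, map_add, map_add, map_add, PowerSeries.coeff_one, PowerSeries.coeff_X,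
    MvPowerSeries.coeff_X, MvPowerSeries.coeff_X, MvPowerSeries.X, MvPowerSeries.X,
    MvPowerSeries.monomial_mul_monomial, MvPowerSeries.coeff_monomial, one_mul]
  have key0 : (Finsupp.single (0 : Fin 2) 1 + Finsupp.single 1 i = Finsupp.single 0 1) ↔ i = 0 := by
    constructor
    · intro h
      have := Finsupp.ext_iff.mp h 1
      simpa using this
    · rintro rfl; simp
  have key1 : ¬ (Finsupp.single (0 : Fin 2) 1 + Finsupp.single 1 i = Finsupp.single 1 1) := by
    intro h
    have := Finsupp.ext_iff.mp h 0
    simp at this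
  have key2 : (Finsupp.single (0 : Fin 2) 1 + Finsupp.single 1 i =
      Finsupp.single 0 1 + Finsupp.single 1 1) ↔ i = 1 := by
    constructor
    · intro h
      have := Finsupp.ext_iff.mp h 1
      simpa using this
    · rintro rfl; rfl
  simp only [key0, key1, key2, if_false, add_zero]

/-- ★ **SUB-STUB T3 «COMPARISON CHAIN RULE» — THE ONLY OPEN PIECE OF THE SPLIT** (typed; NEW helper lemma, size S):
**`ω_f · ϑ' = ε · ω_{f'} ∘ ϑ`** in `𝐃⟦S⟧` — the invariant differential pulls back along Lubin–Tate's comparison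
ISOMORPHISM `ϑ : F_f → F_{f'}` (`ϑ ≡ εS`, `f' ∘ ϑ = ϑ^φ ∘ f`), exactly as it does along the ENDOMORPHISMS `[a]_f` in the
tree's `LubinTate.map_invDiff_mul_derivative_hom` (`ω_F · [a]' = a · ω_F ∘ [a]`).  Stated for general `q` (true as a
formal-group identity: `λ_{f'} ∘ ϑ = ε · λ_f`); at `q = 2`, `ω_f = 1 + S` (`invDiff_two_eq`) turns it into
`(1+S)·ϑ' = ε·ω_{f'}(ϑ)`.  Proof pattern: `map_invDiff_mul_derivative_hom` with the points identity
`evalPt₁_compSeries_ltAdd` (`ϑ(x [+]_f y) = ϑ x [+]_{f'} ϑ y`) replacing `evalAt_ltSMul_invDiff`, or directly from the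
series identity behind `evalPt₁_compSeries_ltAdd` by `∂/∂X` at `X = 0`.
[cite: deShalit1987, I.3.3 (8) (p. 17), I.3.5] [cite: LubinTate1965, Lemma p. 385] -/
def ComparisonChainRule : Prop :=
  PowerSeries.map ((intToUnrCoeff F).comp (LTCoeff.of F).symm.toRingHom)
        (invDiff (isLTRing_LTCoeff h2) (isLTSeries_LTCoeff (((2 : ℕ) : 𝒪[F])))) *
      PowerSeries.derivative (UnrCoeff F) (compSeriesC h2 hσ₀ u hε) =
    PowerSeries.C (PowerSeries.coeff 1 (compSeriesC h2 hσ₀ u hε)) *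
      PowerSeries.subst (compSeriesC h2 hσ₀ u hε)
        ((invDiff (isLTRing_LTCoeff (isUniformizer_unit_mul h2 u))
            (isLTSeries_LTCoeff ((u : 𝒪[F]) * ((2 : ℕ) : 𝒪[F])))).map
          ((intToUnrCoeff F).comp (LTCoeff.of F).symm.toRingHom))

/-- ★ **SUB-STUB H5 «TRANSPORTED D-IDENTITY»** (typed, size S⁻): `2Θ(ε) · H_β · V_β = (1+S) · V_β'` with
`V_β := L(Q_β)`.  ⟸ §D `two_mul_relTildeSeries_mul_reflQuot` (PROVED: `2·(δβ)~·Q_β = ω_f·Q_β'` in `𝒪_E⟦X⟧`) applied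
through the ring map `L`, + T3 + `PowerSeries.derivative_subst`/`derivative_map` + `hj` (to identify `L(ω_f)` with
`Θ(ω_{f'}∘ϑ)`). [cite: deShalit1987, I.3.3 (8), I.3.12–3.13] -/
def TransportedDIdentity : Prop :=
  ∀ β : RelNormCoherentUnits (isUniformizer_unit_mul h2 u) E,
    PowerSeries.C (2 * readΘ θ (PowerSeries.coeff 1 (compSeriesC h2 hσ₀ u hε))) *
          transport h2 u E hσ₀ j hε θ
            (relTildeSeries (isUniformizer_unit_mul h2 u) E hq hE hσ₀ (LTCoeff.of F (u : 𝒪[F])) β) *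
        transport h2 u E hσ₀ j hε θ (reflQuot (isUniformizer_unit_mul h2 u) E hq hE hσ₀ β : PowerSeries (unitBall E)) =
      (1 + PowerSeries.X) * PowerSeries.derivative ℂ_[2]
        (transport h2 u E hσ₀ j hε θ (reflQuot (isUniformizer_unit_mul h2 u) E hq hE hσ₀ β : PowerSeries (unitBall E)))

/-- ★ **SUB-STUB H6 «TRANSPORTED CONGRUENCE»** (typed, size XS–S): `‖[S^k](V_β − 1)‖ ≤ ‖2‖` for `V_β = L(Q_β)`.
⟸ §D `reflQuot_sub_one_mem` (PROVED: `Q_β ≡ 1 (mod π')` coefficientwise) + coefficient bookkeeping through `map j`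
(`hj`: `j(π') = ι(π')`), `subst ϑ` (finite sums `Σ_d [X^d](Q−1)·[S^k]ϑ^d`, `ϑ(0) = 0`) and `map Θ` (`‖Θ(x)‖ ≤ 1`,
`‖Θ(ι π')‖ = ‖2u‖ = ‖2‖`). [cite: deShalit1987, I.3.12] -/
def TransportedCongruence : Prop :=
  ∀ β : RelNormCoherentUnits (isUniformizer_unit_mul h2 u) E, ∀ k : ℕ,
    ‖PowerSeries.coeff k
        (transport h2 u E hσ₀ j hε θ (reflQuot (isUniformizer_unit_mul h2 u) E hq hE hσ₀ β : PowerSeries (unitBall E)) - 1)‖ ≤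
      ‖(2 : ℂ_[2])‖

variable (hθ1 : ∀ z : CBall F, ‖θ (z : CompletedAlgClosure F)‖ ≤ 1)

omit [Normal F E] [IsGalois F E] in
include hθ1 in
/-- `‖Θ(x)‖ ≤ 1` on `𝐃`. [folklore] -/
theorem norm_readΘ_le (x : UnrCoeff F) : ‖readΘ θ x‖ ≤ 1 := hθ1 _

omit [Normal F E] [IsGalois F E] in
include hθ1 in
/-- **`e := Θ(ε)` is admissible** (PROVED): `ε = [S]ϑ` is a unit of `𝐃` (`isUnit_coeff_one_compSeriesC`), so `Θ(ε) ≠ 0`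
and `‖Θ(ε)⁻¹‖ = ‖Θ(ε⁻¹)‖ ≤ 1`. [cite: LubinTate1965, Lemma p. 385] -/
theorem readΘ_coeff_one_admissible :
    readΘ θ (PowerSeries.coeff 1 (compSeriesC h2 hσ₀ u hε)) ≠ 0 ∧
      ‖(readΘ θ (PowerSeries.coeff 1 (compSeriesC h2 hσ₀ u hε)))⁻¹‖ ≤ 1 := by
  obtain ⟨v, hv⟩ := isUnit_coeff_one_compSeriesC h2 hσ₀ u hε
  rw [← hv]
  have hmul : readΘ θ (v : UnrCoeff F) * readΘ θ (↑v⁻¹ : UnrCoeff F) = 1 := by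
    rw [← map_mul, Units.mul_inv, map_one]
  have hne : readΘ θ (v : UnrCoeff F) ≠ 0 := fun h0 => by
    rw [h0, zero_mul] at hmul; exact zero_ne_one hmul
  refine ⟨hne, ?_⟩
  rw [← mul_eq_one_iff_eq_inv₀ hne |>.mp (by rw [mul_comm]; exact hmul)]
  exact norm_readΘ_le θ hθ1 _

variable (hj : j.comp (algebraMap (LTCoeff F) (unitBall E)) = (intToUnrCoeff F).comp (LTCoeff.of F).symm.toRingHom)

include hj hθ1 in
/-- ★★ **H6 «TRANSPORTED CONGRUENCE» IS PROVED** (given `hj`, `hθ1` of the family of record): `Q_β ≡ 1 (mod π')` in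
`𝒪_E⟦X⟧` (§D) survives `map j` (`j(π') = ι(π')`), `subst ϑ` (finite sums, `ϑ(0) = 0`) and `map Θ` (`‖Θ‖ ≤ 1`,
`‖Θ(ι(2u))‖ ≤ ‖2‖`).  So the split of R218 has only TWO open sub-stubs left: T3 and H5. [cite: deShalit1987, I.3.12] -/
theorem transportedCongruence_holds : TransportedCongruence h2 u E hq hE hσ₀ j hε θ := by
  intro β k
  set π' : 𝒪[F] := (u : 𝒪[F]) * ((2 : ℕ) : 𝒪[F]) with hπ'
  set Q : PowerSeries (unitBall E) :=
    (reflQuot (isUniformizer_unit_mul h2 u) E hq hE hσ₀ β : PowerSeries (unitBall E)) with hQdef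
  have hs := hasSubst_compSeriesC h2 hσ₀ u hε
  -- (1) `L(Q) − 1 = L(Q − 1)`
  have h1 : transport h2 u E hσ₀ j hε θ (Q - 1) = transport h2 u E hσ₀ j hε θ Q - 1 := by
    unfold transport
    rw [map_sub (PowerSeries.map j), map_one, ← PowerSeries.coe_substAlgHom hs, map_sub, map_one, map_sub, map_one]
  -- (2) all coefficients of `j(Q − 1) ∘ ϑ` lie in `(j π')`
  set J : Ideal (UnrCoeff F) := Ideal.span {j (algebraMap 𝒪[F] (unitBall E) π')} with hJ
  have hQ := reflQuot_sub_one_mem (isUniformizer_unit_mul h2 u) E hq hE hσ₀ β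
  have hmapj : ∀ n, PowerSeries.coeff n ((Q - 1).map j) ∈ J := fun n => by
    rw [PowerSeries.coeff_map]
    obtain ⟨b, hb⟩ := Ideal.mem_span_singleton'.mp (mem_coeffIdeal_iff.mp hQ n)
    exact Ideal.mem_span_singleton'.mpr ⟨j b, by rw [← map_mul, hb]⟩
  have hsubst : ∀ n, PowerSeries.coeff n (PowerSeries.subst (compSeriesC h2 hσ₀ u hε) ((Q - 1).map j)) ∈ J := fun n => by
    rw [PowerSeries.coeff_subst' hs]
    exact finsum_induction (· ∈ J) J.zero_mem (fun _ _ hx hy => J.add_mem hx hy)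
      fun d => by rw [smul_eq_mul]; exact J.mul_mem_right _ (hmapj d)
  -- (3) the generator reads `Θ(ι(u)) · 2`
  have hgen : ‖readΘ θ (j (algebraMap 𝒪[F] (unitBall E) π'))‖ ≤ ‖(2 : ℂ_[2])‖ := by
    have e1 : j (algebraMap 𝒪[F] (unitBall E) π') = intToUnrCoeff F π' := RingHom.congr_fun hj (LTCoeff.of F π')
    rw [e1, hπ', map_mul, map_natCast, map_mul, map_natCast, Nat.cast_ofNat, norm_mul]
    calc ‖readΘ θ (intToUnrCoeff F (u : 𝒪[F]))‖ * ‖(2 : ℂ_[2])‖ ≤ 1 * ‖(2 : ℂ_[2])‖ :=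
          mul_le_mul_of_nonneg_right (norm_readΘ_le θ hθ1 _) (norm_nonneg _)
      _ = ‖(2 : ℂ_[2])‖ := one_mul _
  -- (4) conclude
  rw [← h1]
  show ‖PowerSeries.coeff k (PowerSeries.map (readΘ θ)
      (PowerSeries.subst (compSeriesC h2 hσ₀ u hε) ((Q - 1).map j)))‖ ≤ _
  rw [PowerSeries.coeff_map]
  obtain ⟨b, hb⟩ := Ideal.mem_span_singleton'.mp (hsubst k)
  rw [← hb, map_mul, norm_mul]
  calc ‖readΘ θ b‖ * ‖readΘ θ (j (algebraMap 𝒪[F] (unitBall E) π'))‖ ≤ 1 * ‖(2 : ℂ_[2])‖ :=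
        mul_le_mul (norm_readΘ_le θ hθ1 b) hgen (norm_nonneg _) zero_le_one
    _ = ‖(2 : ℂ_[2])‖ := one_mul _

omit [Normal F E] [IsGalois F E] in
/-- Unfolding `L` with `PowerSeries.map` heads. -/
theorem transport_eq (G : PowerSeries (unitBall E)) :
    transport h2 u E hσ₀ j hε θ G =
      PowerSeries.map (readΘ θ) (PowerSeries.subst (compSeriesC h2 hσ₀ u hε) (PowerSeries.map j G)) := rfl

omit [Normal F E] [IsGalois F E] in
/-- `L` is multiplicative. [folklore] -/
theorem transport_mul (G H : PowerSeries (unitBall E)) :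
    transport h2 u E hσ₀ j hε θ (G * H) = transport h2 u E hσ₀ j hε θ G * transport h2 u E hσ₀ j hε θ H := by
  rw [transport_eq, transport_eq, transport_eq, map_mul (PowerSeries.map j),
    PowerSeries.subst_mul (hasSubst_compSeriesC h2 hσ₀ u hε), map_mul]

omit [Normal F E] [IsGalois F E] in
/-- `L` is additive. [folklore] -/
theorem transport_add (G H : PowerSeries (unitBall E)) :
    transport h2 u E hσ₀ j hε θ (G + H) = transport h2 u E hσ₀ j hε θ G + transport h2 u E hσ₀ j hε θ H := by
  rw [transport_eq, transport_eq, transport_eq, map_add (PowerSeries.map j),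
    PowerSeries.subst_add (hasSubst_compSeriesC h2 hσ₀ u hε), map_add]

/-- `d⁄dX` commutes with coefficientwise maps (private copy of a tree one-liner). [folklore] -/
private theorem derivative_map' {R T : Type*} [CommRing R] [CommRing T] (φ : R →+* T) (G : PowerSeries R) :
    PowerSeries.derivative T (PowerSeries.map φ G) = PowerSeries.map φ (PowerSeries.derivative R G) := by
  ext n
  simp only [PowerSeries.coeff_derivative, PowerSeries.coeff_map, map_mul, map_add, map_natCast, map_one]

include hj in
/-- ★★ **H5 ⟸ T3 (PROVED)**: the transported `D`-identity follows from the comparison chain rule alone — push §D's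
`2·(δβ)~·Q_β = ω_f·Q_β'` through the ring map `L = Θ ∘ (∘ϑ) ∘ j`, use `(G∘ϑ)' = (G'∘ϑ)·ϑ'` (`PowerSeries.derivative_subst`)
and `(1+S)ϑ' = ε·ω_{f'}(ϑ)` (T3), and identify `L(ω_f) = Θ(ω_{f'}∘ϑ)` by `hj`.  Hence **R218 ⟸ T3** with everything
else in this file proved. [cite: deShalit1987, I.3.3 (8), I.3.5, I.3.12–3.13] -/
theorem transportedDIdentity_of_comparisonChainRule (hT3 : ComparisonChainRule h2 u hσ₀ hε) :
    TransportedDIdentity h2 u E hq hE hσ₀ j hε θ := by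
  intro β
  have hs : PowerSeries.HasSubst (compSeriesC h2 hσ₀ u hε) := hasSubst_compSeriesC h2 hσ₀ u hε
  -- T3 at `q = 2`: `(1+S)·ϑ' = ε·ω_{f'}(ϑ)`
  have hT3' := hT3
  rw [ComparisonChainRule, invDiff_two_eq h2 hq, map_add, map_one, PowerSeries.map_X] at hT3'
  have hD := two_mul_relTildeSeries_mul_reflQuot (isUniformizer_unit_mul h2 u) E hq hE hσ₀ (of_unit_mul_two_eq hq u) β
  set Q : PowerSeries (unitBall E) :=
    (reflQuot (isUniformizer_unit_mul h2 u) E hq hE hσ₀ β : PowerSeries (unitBall E)) with hQ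
  set T := relTildeSeries (isUniformizer_unit_mul h2 u) E hq hE hσ₀ (LTCoeff.of F (u : 𝒪[F])) β with hT
  set ι := invDiff (isLTRing_LTCoeff (isUniformizer_unit_mul h2 u))
    (isLTSeries_LTCoeff ((u : 𝒪[F]) * ((2 : ℕ) : 𝒪[F]))) with hι
  set Sι : PowerSeries ℂ_[2] := PowerSeries.map (readΘ θ) (PowerSeries.subst (compSeriesC h2 hσ₀ u hε)
    (PowerSeries.map ((intToUnrCoeff F).comp (LTCoeff.of F).symm.toRingHom) ι)) with hSι
  set e : ℂ_[2] := readΘ θ (PowerSeries.coeff 1 (compSeriesC h2 hσ₀ u hε)) with he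
  -- (i) `L(2·T·Q) = 2·L(T)·L(Q)`
  have h1 : transport h2 u E hσ₀ j hε θ (2 * T * Q) =
      2 * transport h2 u E hσ₀ j hε θ T * transport h2 u E hσ₀ j hε θ Q := by
    rw [transport_mul, two_mul, transport_add, ← two_mul]
  -- (ii) `L(ω_f) = Θ(ω_{f'} ∘ ϑ)` (by `hj`)
  have h2' : transport h2 u E hσ₀ j hε θ (PowerSeries.map (algebraMap (LTCoeff F) (unitBall E)) ι) = Sι := by
    rw [transport_eq, ← RingHom.comp_apply (PowerSeries.map j), ← PowerSeries.map_comp, hj]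
  have h3 : transport h2 u E hσ₀ j hε θ
        (PowerSeries.map (algebraMap (LTCoeff F) (unitBall E)) ι * PowerSeries.derivative (unitBall E) Q) =
      Sι * transport h2 u E hσ₀ j hε θ (PowerSeries.derivative (unitBall E) Q) := by
    rw [transport_mul, h2']
  -- (iii) `(1+S)·(L Q)' = e · L(Q') · Θ(ω_{f'}∘ϑ)` (chain rule + T3)
  have h4 : (1 + PowerSeries.X) * PowerSeries.derivative ℂ_[2] (transport h2 u E hσ₀ j hε θ Q) =
      PowerSeries.C e * transport h2 u E hσ₀ j hε θ (PowerSeries.derivative (unitBall E) Q) * Sι := by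
    have h1X : (1 + PowerSeries.X : PowerSeries ℂ_[2]) = PowerSeries.map (readΘ θ) (1 + PowerSeries.X) := by
      rw [map_add, map_one, PowerSeries.map_X]
    rw [transport_eq, transport_eq, derivative_map', PowerSeries.derivative_subst (UnrCoeff F) hs, derivative_map',
      h1X, ← map_mul, mul_left_comm, hT3', map_mul, map_mul, PowerSeries.map_C]
    ring
  -- (iv) assemble
  have hD' := congrArg (transport h2 u E hσ₀ j hε θ) hD
  rw [h1, h3] at hD'
  rw [h4, map_mul, map_ofNat]
  calc 2 * PowerSeries.C e * transport h2 u E hσ₀ j hε θ T * transport h2 u E hσ₀ j hε θ Q =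
      PowerSeries.C e * (2 * transport h2 u E hσ₀ j hε θ T * transport h2 u E hσ₀ j hε θ Q) := by ring
    _ = PowerSeries.C e * (Sι * transport h2 u E hσ₀ j hε θ (PowerSeries.derivative (unitBall E) Q)) := by rw [hD']
    _ = PowerSeries.C e * transport h2 u E hσ₀ j hε θ (PowerSeries.derivative (unitBall E) Q) * Sι := by ring

include hθ1 in
/-- ★★★ **THE SPLIT OF R218 «PRIM₂» — GLUE PROVED.**  The two transported sub-stubs H5 (D-identity) and H6
(congruence) imply k3-g38's `BoundedPrimitive H 1` for the VERBATIM relative tilde family of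
`seriesFamily_hsock_of_relNormCoherentUnits` (any index map `η`, e.g. the route's `b ↦ β_b`): the primitive of
`H_{η b}` is `(2Θ(ε))⁻¹ · log (V_{η b}/V_{η b}(0))`, bounded by `1` by the dyadic Dwork lemma.  R218 with bound `C ≥ 1`
follows by `BoundedPrimitive.mono`.  (BSD is not proved; this closes NO item — it re-cuts one node of the stub plan.)
[cite: deShalit1987, I.3.3 (7′) (p. 17), I.3.12–3.13] -/
theorem boundedPrimitive_of_transported {B : Type*} (η : B → RelNormCoherentUnits (isUniformizer_unit_mul h2 u) E)
    (hD : TransportedDIdentity h2 u E hq hE hσ₀ j hε θ) (hC : TransportedCongruence h2 u E hq hE hσ₀ j hε θ) :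
    BoundedPrimitive (fun b : B =>
      (PowerSeries.subst (compSeriesC h2 hσ₀ u hε)
        ((relTildeSeries (isUniformizer_unit_mul h2 u) E hq hE hσ₀ (LTCoeff.of F (u : 𝒪[F])) (η b)).map j)).map
        (θ.comp ((CBall F).subtype.comp (algebraMap (UnrCoeff F) (CBall F))))) 1 := by
  haveI : IsUltrametricDist ℂ_[2] := inferInstance
  obtain ⟨hne, hinv⟩ := readΘ_coeff_one_admissible h2 u hσ₀ hε θ hθ1
  exact boundedPrimitive_of_hasReflectionDatum _ fun b =>
    hasReflectionDatum_of_unnormalised (hC (η b)) hne hinv (hD (η b))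

include hj hθ1 in
/-- ★★★ **R218 «PRIM₂» ⟸ H5 alone** (H6 discharged): the bounded `D`-primitive of the whole relative tilde family follows
from the single transported `D`-identity `2Θ(ε)·H_β·V_β = (1+S)V_β'` — itself ⟸ T3 «comparison chain rule» + ring-hom
bookkeeping.  BSD is not proved; no item closes. [cite: deShalit1987, I.3.3 (7′), I.3.12–3.13] -/
theorem boundedPrimitive_of_transportedDIdentity {B : Type*}
    (η : B → RelNormCoherentUnits (isUniformizer_unit_mul h2 u) E) (hD : TransportedDIdentity h2 u E hq hE hσ₀ j hε θ) :
    BoundedPrimitive (fun b : B =>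
      (PowerSeries.subst (compSeriesC h2 hσ₀ u hε)
        ((relTildeSeries (isUniformizer_unit_mul h2 u) E hq hE hσ₀ (LTCoeff.of F (u : 𝒪[F])) (η b)).map j)).map
        (θ.comp ((CBall F).subtype.comp (algebraMap (UnrCoeff F) (CBall F))))) 1 :=
  boundedPrimitive_of_transported h2 u E hq hE hσ₀ j hε θ hθ1 η hD
    (transportedCongruence_holds h2 u E hq hE hσ₀ j hε θ hθ1 hj)

include hj hθ1 in
/-- ★★★★ **R218 «PRIM₂» ⟸ T3 «COMPARISON CHAIN RULE» ALONE** — the deliverable of this k = 3 seat: the bounded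
`D`-primitive of the ENTIRE relative tilde family of record (bound `1`, any index map `η`) follows from the single
Lubin–Tate identity `(1+S)·ϑ'(S) = ε·ω_{f'}(ϑ(S))`; reflection form, congruence, transport, Dwork lemma and glue are all
proved above.  BSD is not proved; no ledger item closes; this re-cuts node R218 of STUB-PLAN v7.1 into ONE S-sized lemma.
[cite: deShalit1987, I.3.3 (7′)–(8), I.3.5, I.3.12–3.13] [cite: LubinTate1965, Lemma p. 385] -/
theorem boundedPrimitive_of_comparisonChainRule {B : Type*}
    (η : B → RelNormCoherentUnits (isUniformizer_unit_mul h2 u) E) (hT3 : ComparisonChainRule h2 u hσ₀ hε) :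
    BoundedPrimitive (fun b : B =>
      (PowerSeries.subst (compSeriesC h2 hσ₀ u hε)
        ((relTildeSeries (isUniformizer_unit_mul h2 u) E hq hE hσ₀ (LTCoeff.of F (u : 𝒪[F])) (η b)).map j)).map
        (θ.comp ((CBall F).subtype.comp (algebraMap (UnrCoeff F) (CBall F))))) 1 :=
  boundedPrimitive_of_transportedDIdentity h2 u E hq hE hσ₀ j hε θ hθ1 hj η
    (transportedDIdentity_of_comparisonChainRule h2 u E hq hE hσ₀ j hε θ hj hT3)

end Transport

end Summit.BirchSwinnertonDyer.BirchSwinnertonDyer.Cruxes.SplitBadTwoLowerHalfOfFacts.ReflectionPrimitiveK3G39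

end

noncomputable section

/-! ## §CRITIC (stub-critic g41, 2026-08-29) — JUNCTION CERTIFICATE for row 116 (card k1-g38 «TWISTED RIGIDITY»)

The two sketches above are BYTE COPIES of the crux workfiles
`STUB_IDEAS_stub_heegnerIndexLowerAtTwo_1_g38.lean` (sha256-16 `eb748f7322e27076`, body after the import lines) and
`STUB_IDEAS_stub_heegnerIndexLowerAtTwo_3_g39.lean` (sha256-16 `a08256b05cf54030`, body after the import lines),
concatenated under the union of their imports.  Below, with NO new hypothesis:

* `comparisonChainRule_holds` — k3-g39's typed node `ReflectionPrimitiveK3G39.ComparisonChainRule h2 u hσ₀ hε`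
  (R218a′ «CHAIN-RULE₂» of STUB-PLAN v7.3, the Prop itself, not a restatement) is a THEOREM, by k1-g38's
  `TwistedRigidityK1G38.comparisonChainRule_two` — the junction the card calls K1;
* `transportedDIdentity_holds` — R218-H5 `TransportedDIdentity` (the READ₂-REFL engine's `D`-identity
  `2Θ([S¹]ϑ)·H_β·V_β = (1+S)·V_β'`) is unconditional (hypotheses: the tree block's section variables + `hj`);
* `boundedPrimitive_one_series_side` — k3-g39's `boundedPrimitive_of_comparisonChainRule` with its last open
  hypothesis removed: a SECOND, series-side kernel proof of R218 «PRIM₂» at `C = 1` for the family of record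
  (the first is row 115's measure-side `LogFreePrimitiveK2G39.boundedPrimitive_relNormCoherentUnits[_one]`),
  hypotheses `hq hE hσ₀ j hε θ hθ1 hj` ⊂ ★`seriesFamily_hsock_of_relNormCoherentUnits`'s + the served `hj`.
BSD is not proved; the stub and the crux are not proved. -/

namespace Summit.BirchSwinnertonDyer.BirchSwinnertonDyer.Cruxes.SplitBadTwoLowerHalfOfFacts.CriticG41

open Literature.NumberTheory.GaloisRepresentations
open Literature.NumberTheory.GaloisRepresentations.IsNonarchimedeanLocalField
open Literature.NumberTheory.GaloisRepresentations.LubinTate ValuativeRel Field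
open Literature.NumberTheory.PAdicHodge
open Literature.NumberTheory.EllipticCurves

variable {F : Type} [Field F] [ValuativeRel F] [TopologicalSpace F] [IsNonarchimedeanLocalField F]

attribute [local instance] ltNormUniformSpace ltNormIsUniformAddGroup rk1 nF nE fintypeResidueField

variable (h2 : (valuation F).IsUniformizer (((2 : ℕ) : 𝒪[F]) : F)) (u : 𝒪[F]ˣ)
variable (E : IntermediateField F (AlgebraicClosure F)) [FiniteDimensional F E] [Normal F E] [IsGalois F E]
  (hq : residueFieldCard F = 2) (hE : E ≤ maxUnramified F) {σ₀ : absoluteGaloisGroup F} (hσ₀ : IsAbsArithFrob σ₀)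
  (j : unitBall E →+* UnrCoeff F)
variable {ε : (maxUnramifiedCompletion F)ˣ}
  (hε : maxUnramifiedCompletion.galAut F σ₀ (ε : maxUnramifiedCompletion F) =
    algebraMap 𝒪[F] (maxUnramifiedCompletion F) (u : 𝒪[F]) * (ε : maxUnramifiedCompletion F))
variable (θ : CompletedAlgClosure F →+* ℂ_[2])
variable (hθ1 : ∀ z : CBall F, ‖θ (z : CompletedAlgClosure F)‖ ≤ 1)
variable (hj : j.comp (algebraMap (LTCoeff F) (unitBall E)) = (intToUnrCoeff F).comp (LTCoeff.of F).symm.toRingHom)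

/-- **R218a′ «CHAIN-RULE₂» CLOSED**: k3-g39's Prop `ComparisonChainRule h2 u hσ₀ hε`, by k1-g38's theorem (term-mode,
no `unfold`: the def body and the theorem statement are the same term). -/
theorem comparisonChainRule_holds : ReflectionPrimitiveK3G39.ComparisonChainRule h2 u hσ₀ hε :=
  TwistedRigidityK1G38.comparisonChainRule_two u hσ₀ hε h2

include hj in
/-- **R218-H5 «TRANSPORTED D-IDENTITY» unconditional** (READ₂-REFL engine). -/
theorem transportedDIdentity_holds :
    ReflectionPrimitiveK3G39.TransportedDIdentity h2 u E hq hE hσ₀ j hε θ :=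
  ReflectionPrimitiveK3G39.transportedDIdentity_of_comparisonChainRule h2 u E hq hE hσ₀ j hε θ hj
    (comparisonChainRule_holds h2 u hσ₀ hε)

include hj hθ1 in
/-- **R218 «PRIM₂» at `C = 1`, SERIES SIDE, unconditional** (cross-check of row 115; family of record verbatim). -/
theorem boundedPrimitive_one_series_side {B : Type*}
    (η : B → RelNormCoherentUnits (isUniformizer_unit_mul h2 u) E) :
    ReflectionPrimitiveK3G39.BoundedPrimitive (fun b : B =>
      (PowerSeries.subst (compSeriesC h2 hσ₀ u hε)
        ((relTildeSeries (isUniformizer_unit_mul h2 u) E hq hE hσ₀ (LTCoeff.of F (u : 𝒪[F])) (η b)).map j)).map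
        (θ.comp ((CBall F).subtype.comp (algebraMap (UnrCoeff F) (CBall F))))) 1 :=
  ReflectionPrimitiveK3G39.boundedPrimitive_of_comparisonChainRule h2 u E hq hE hσ₀ j hε θ hθ1 hj η
    (comparisonChainRule_holds h2 u hσ₀ hε)

/-! ### B68 degenerate-instance checks of the new lemma `twisted_rigidity` -/

/-- With `M₁ = M₂ = 0` the separatedness hypothesis is unsatisfiable over a nontrivial ring (so the lemma is
not vacuously strong): `hsep` would force every `x` to vanish. -/
example {A : Type*} [CommRing A] [Nontrivial A] (φ : A →+* A) (π : A) (n₀ : ℕ)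
    (hsep : ∀ n, n₀ ≤ n → ∀ x : A,
      PowerSeries.constantCoeff (0 : PowerSeries A) * x =
        PowerSeries.constantCoeff (0 : PowerSeries A) * π ^ n * φ x → x = 0) : False := by
  have h := hsep n₀ le_rfl 1 (by simp)
  exact one_ne_zero h

/-- With `D = 0` the conclusion holds trivially and the recursion hypothesis is `0 = 0` — consistent. -/
example {A : Type*} [CommRing A] (φ : A →+* A) (f M₁ M₂ : PowerSeries A)
    (hf0 : PowerSeries.constantCoeff f = 0) :
    (PowerSeries.map φ (0 : PowerSeries A)).subst f * M₁ = (0 : PowerSeries A) * M₂ := by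
  have hs : PowerSeries.HasSubst f := PowerSeries.HasSubst.of_constantCoeff_zero' hf0
  rw [map_zero, zero_mul, ← PowerSeries.coe_substAlgHom hs, map_zero, zero_mul]

end Summit.BirchSwinnertonDyer.BirchSwinnertonDyer.Cruxes.SplitBadTwoLowerHalfOfFacts.CriticG41

end
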